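import Summits.Schanuel.Schanuel.Theorems.DiophantineDichotomyDefs
import Summits.Schanuel.Schanuel.Theorems.DiophantineDichotomyKhovanskiiApproxTypeSlotDichotomyTwo
import Literature.NumberTheory.DiophantineApproximation.ApproximationByAlgebraicNumbersProofs
import Literature.NumberTheory.DiophantineApproximation.IntegerPolynomialSmallValue

/-!
# Disproof work file for crux `KhovanskiiApproxType` (stmt-Schanuel-6116) — findings

Standing adversary (`cdisprove`, refuter-cdisprove-stmt-Schanuel-6116-0) on
`Summit.Schanuel.Schanuel.Theses.DiophantineDichotomy.KhovanskiiApproxType`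
(route `DiophantineDichotomy`): *for `n ≥ 2` and every free Khovanskii point `θ = (s, e^s) ∈ ℂ²ⁿ`
with `ℚ`-linearly independent `s`, `∃ a < 1/(n−1), b, C > 0` with
`‖γ − θ‖ ≥ exp(−C(dᵃ log H + dᵇ))` for every algebraic challenger `γ` of field degree `≤ d` whose
coordinates are roots of non-zero integer polynomials of degree `≤ d`, height `≤ H`.*
Vocabulary `IsFreeKhovanskii`, `ApproxTypeAt`, `khovanskiiApproxType_iff` (`Iff.rfl`) is IMPORTED from
the line lead's accepted definitions module `Theorems/DiophantineDichotomyDefs.lean` (namespace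
`Summit.Schanuel.Schanuel.Cruxes.KhovanskiiApproxType.LwSmallHeight`): the crux is
`∀ n s, 2 ≤ n → LinearIndependent ℚ s → IsFreeKhovanskii n s → ∃ a b C, a < 1/(n−1) ∧ ApproxTypeAt n s a b C`.
LANDED / PROPOSED (namespace `…KhovanskiiApproxType.Negative`, lane `Theorems/KhovanskiiApproxType/Negative/`):
`LoadBearing.lean` (p74852 ACCEPTED: engine + (a)), `NonUniform.lean` (p74863 ACCEPTED: (b)),
`LiouvilleTower.lean` (p75261 ACCEPTED), `WithoutKhovanskiiPieces.lean` (p75268 ACCEPTED),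
`WithoutKhovanskiiStage.lean` (p75553), `WithoutKhovanskii.lean` (p75837: (a′)), `SlotFloorDirichlet.lean`
(p75841: (d′)).

## Verdict so far: NO KILL of the crux as typed (cycle 1) — but EVERY hypothesis is load-bearing (kernel-checked). Why it resists
* The typed statement is faithful (all junk corners neutralised: `d = 0`/`H = 0` are excluded by the
  non-zero-polynomial clause, so `d ≥ 1`, `H ≥ 1`, `log H ≥ 0`, `(d:ℝ)^a` is an honest `rpow` on a base
  `≥ 1`; `1/((n:ℝ)−1)` is guarded by `2 ≤ n`; sup norm; `θ` is never algebraic in every coordinate by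
  Hermite–Lindemann since `sᵢ ≠ 0`). A kill needs ONE free Khovanskii point with lin. independent `s`
  and simultaneous algebraic approximations of quality `ω(d^a log H + d^b)` for EVERY `a < 1/(n−1)`,
  `b`, `C` — i.e. (letting `H → ∞` at fixed `d`) a simultaneously-Liouville point, or (letting
  `d → ∞`, `log H` super-polynomial in `d`) approximation exponent `≥ 1/(n−1)` in the degree aspect.
  Free Khovanskii points are isolated zeros of countably many ℚ-systems: no Liouville coordinate can be
  planted, and exponent `≥ 1/(n−1) > 1/n` at a point of transcendence degree `n` would beat the
  generic exponent `1/trdeg` (Waldschmidt 2004 p.14 / GL326 Conj. 15.31; Amoroso, NP2001 Ch.15);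
  exponent `≥ 1/(n−1)` is forced only when `trdeg θ ≤ n − 1`, i.e. at a SCHANUEL COUNTEREXAMPLE
  (the route's own race, `ApproximationRace`). So `¬crux` ⟸⟹(morally) "an abnormally approximable
  free Khovanskii point exists" — open in both directions; nothing in print or in the tree decides it
  (`ledger negatives --problem Schanuel`: 2 PolarPhantoms refutations, unrelated).
* What IS decidable now is which hypotheses carry the load, and that the exponent window `a < 1`
  is razor-sharp: Diaz's theorem (Bugeaud 2004 Thm 8.11, PROVED in tree as
  `Literature.NumberTheory.DiophantineApproximation.Bugeaud2004_thm_8_11_holds`) supplies, for EVERY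
  complex `ξ`, challengers of degree `≤ n` with quality `0.006(n log M(α) + deg α · log M)` —
  linear in the degree budget, at every large scale `M`. Hence the measure shape
  `exp(−C(dᵃ log H + dᵇ))` with `a < 1` is FALSE at any point all of whose transcendental coordinates
  are ONE number `ξ` (theorem `not_approxTypeAt_const_one` below, kernel-checked, no sorry).

## Contents (a)–(e) as required by the cdisprove protocol
(a) LOAD-BEARING ANALYSIS — kernel-checked:
  * `khovanskiiApproxType_false_without_twoLe` : `¬ KhovanskiiApproxTypeWithoutTwoLe`
    (drop `2 ≤ n`; witness `n = 0`: the empty challenger has distance `0`) and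
    `khovanskiiApproxType_false_from_one` : `¬ KhovanskiiApproxTypeFromOne` (weaken to `1 ≤ n`;
    witness the Hermite–Lindemann point `s = (1)`, `θ = (1, e)`: the typed bound reads
    `a < 1/((1:ℝ)−1) = 0`, and Diaz beats every `a < 1`).
  * `khovanskiiApproxType_false_without_linIndep` : `¬ KhovanskiiApproxTypeWithoutLinIndep`
    (drop `LinearIndependent ℚ s`; witness `s = (1, 1)`, `θ = (1, 1, e, e)`, challengers `(1, 1, α, α)`
    with `α` from Diaz — ANY PROOF MUST USE LINEAR INDEPENDENCE, and must use it to force at least two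
    "independent transcendental directions" among the coordinates of `θ`).
  * `khovanskiiApproxType_false_without_khovanskii` : `¬ KhovanskiiApproxTypeWithoutKhovanskii`
    (drop the Khovanskii system, KEEP linear independence) — kernel-checked, section (a′): the witness is
    the Gel'fond–Schneider-type point `s = (log 2, r·log 2)`, `θ = (log 2, r log 2, 2, 2^r)`, with
    `r = ∑ⱼ 10^{−t_j}` the ultra-Liouville number of the tower `t₀ = 1`, `t_{j+1} = 10^{(j+1)² t_j}`
    (`Tower.r`, `Tower.liouville_r`; `s` is lin. independent since `r ∉ ℚ`). `θ` is the hyper-fast limit of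
    the DEGENERATE (lin. dependent) points `θ_k = (log 2, r_k log 2, 2, 2^{r_k})`, `r_k = p_k/q_k`,
    `q_k = 10^{t_k}`, each generated by the single number `ξ_k = (log 2)/q_k`; Diaz's challengers
    `(q_k α, p_k α, 2, 2^{p_k/q_k}) ∈ ℚ(α, 2^{1/q_k})` (budget `d = n q_k`, `n = q_k^k`) beat every `a < 1`
    (`stage` + `stage_choice_*`). Moral for provers: non-degeneracy must be used QUANTITATIVELY — it is
    exactly what excludes such limits of degenerate configurations, and `C(θ)` blows up along them.
(b) TIGHTNESS — kernel-checked: the constants cannot be uniform in the point,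
    `not_khovanskiiApproxTypeUniform : ¬ KhovanskiiApproxTypeUniform` (free Khovanskii points
    `s_k = (x_k, √2 x_k)`, `k x_k e^{x_k} = 1`, `0 < x_k ≤ 1/k`, with lin. independent `s_k`, accumulate at
    the ALGEBRAIC point `(0, 0, 1, 1)`, an admissible challenger with `d = H = 1`; so `C(θ) → ∞` there).
(c) NATURAL STRENGTHENINGS refuted: `a < 1` at the `n = 1` (Hermite–Lindemann) layer is false
    so the crux window `[1/n, 1/(n−1))` cannot be opened to include
    `n = 1` (`not_approxTypeAt_const_one 1`), and at `n = 2` any proof of `a < 1` must exploit BOTH transcendental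
    directions (a measure driven by one slot alone is impossible). Route-review floor (evidence SchanuelRouteReview.md):
    `a < 1/n` is refuted by AP(n) at `θ` (AP(2) printed-proved, not in tree) — not formalised here.
(d) TARGETS (lead's stuck stubs): none yet (payload.targets = []). Stub audit: `SlotFloor ξ A K C`
    needs `A ≥ 1` — KERNEL-CHECKED as `slotFloor_false_of_lt_one` (section (d′), Bugeaud Lemma 8.1
    `exists_int_poly_small_value` + the lead's `toMvPolynomial` plumbing; landed as
    `Negative/SlotFloorDirichlet.lean`, p75841); `CodimOneMeasure 2 ω μ K C` needs `μ ≥ 2`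
    (two-variable Dirichlet, not in tree — informal); `PrimitiveApproxMeasure 2 ω p q C` is false for `p < 1` whenever `ω` has a coordinate
    `ξ` with the other in `ℚ(ξ)` polynomially (Diaz again) — consistent with the line's use
    (`p = (μ+1)/2 ≥ 3/2`). No stub is cheaply false; `NonLWInputsTwo` is Schanuel-strength (contains
    `e ⊥ π` with a measure), `RankThreeUp` is the crux for `n ≥ 3` verbatim.
(e) NEAR-MISSES: none open in Lean at the end of cycle 1 (all of (a), (a′), (b) are sorry-free).
    NOT formalised: the route-review floor `a ≥ 1/n` (needs AP(2), printed-proved, not in tree); the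
    `Injective s` variant of (a) (`s = (1, 2)`, `θ = (1, 2, e, e²)`, challengers `(1, 2, α, α²)` — same
    engine, needs only the height of `α²` via `contract 2 (P·P(−X))`; routine).
-/

noncomputable section

set_option linter.dupNamespace false

namespace Summit.Schanuel.Schanuel.Cruxes.KhovanskiiApproxType.Disproof

open Summit.Schanuel.Schanuel.Theses.DiophantineDichotomy (KhovanskiiApproxType)
open Summit.Schanuel.Schanuel.Cruxes.KhovanskiiApproxType.LwSmallHeight
open Polynomial
open Literature.NumberTheory.DiophantineApproximation (Bugeaud2004_thm_8_11_holds
  one_le_mahlerMeasure_map)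

/-! ## Bookkeeping: heights, the degree choice in Diaz's theorem -/

/-- Naive height `max_k |coeff_k P|` of an integer polynomial, as a natural number. -/
def natHeight (P : ℤ[X]) : ℕ := P.support.sup fun k => (P.coeff k).natAbs

theorem abs_coeff_le_natHeight (P : ℤ[X]) (k : ℕ) : |P.coeff k| ≤ (natHeight P : ℤ) := by
  by_cases hk : k ∈ P.support
  · have h : (P.coeff k).natAbs ≤ natHeight P :=
      Finset.le_sup (f := fun k => (P.coeff k).natAbs) hk
    calc |P.coeff k| = ((P.coeff k).natAbs : ℤ) := (Int.natCast_natAbs _).symm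
      _ ≤ natHeight P := by exact_mod_cast h
  · rw [Polynomial.notMem_support_iff.mp hk, abs_zero]
    positivity

theorem one_le_natHeight (P : ℤ[X]) (hP : P ≠ 0) : 1 ≤ natHeight P := by
  have hmem : P.natDegree ∈ P.support := natDegree_mem_support_of_nonzero hP
  have h1 : 1 ≤ (P.coeff P.natDegree).natAbs :=
    Int.natAbs_pos.mpr (leadingCoeff_ne_zero.mpr hP)
  exact h1.trans (Finset.le_sup (f := fun k => (P.coeff k).natAbs) hmem)

/-- `H(P) ≤ 2^{deg P} M(P)` (binomial bound on the coefficients by the Mahler measure). -/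
theorem natHeight_le (P : ℤ[X]) :
    (natHeight P : ℝ) ≤ 2 ^ P.natDegree * (P.map (Int.castRingHom ℂ)).mahlerMeasure := by
  by_cases hP : P = 0
  · subst hP; simp [natHeight]
  obtain ⟨k, -, hk⟩ := Finset.exists_mem_eq_sup P.support (support_nonempty.mpr hP)
    (fun k => (P.coeff k).natAbs)
  unfold natHeight
  rw [hk]
  have h1 := norm_coeff_le_choose_mul_mahlerMeasure k (P.map (Int.castRingHom ℂ))
  rw [coeff_map, eq_intCast, Complex.norm_intCast,
    natDegree_map_eq_of_injective Int.cast_injective] at h1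
  have h2 : ((P.coeff k).natAbs : ℝ) = |((P.coeff k : ℤ) : ℝ)| := by
    rw [← Int.cast_natCast, Int.natCast_natAbs, Int.cast_abs]
  rw [h2]
  refine h1.trans ?_
  gcongr
  · exact mahlerMeasure_nonneg _
  · exact_mod_cast Nat.choose_le_two_pow _ _

/-- Choice of the degree in Diaz's theorem: for `a' < 1`, `C > 0` some `n ≥ 50` has
`C n^{a'} ≤ 0.003 n`. -/
theorem exists_deg (a' C : ℝ) (ha1 : a' < 1) (hC : 0 < C) :
    ∃ n : ℕ, 50 ≤ n ∧ C * (n : ℝ) ^ a' ≤ 3 / 1000 * n := by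
  set T : ℝ := C / (3 / 1000) with hT
  have hTpos : 0 < T := by positivity
  set e : ℝ := 1 / (1 - a') with he
  refine ⟨max 50 ⌈T ^ e⌉₊, le_max_left _ _, ?_⟩
  set n : ℕ := max 50 ⌈T ^ e⌉₊ with hn
  have hTn : T ^ e ≤ (n : ℝ) :=
    (Nat.le_ceil _).trans (by exact_mod_cast le_max_right 50 ⌈T ^ e⌉₊)
  have hnpos : (0 : ℝ) < n := by
    have : (50 : ℝ) ≤ n := by exact_mod_cast le_max_left 50 ⌈T ^ e⌉₊
    linarith
  have h1 : T ≤ (n : ℝ) ^ (1 - a') := by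
    have h := Real.rpow_le_rpow (by positivity) hTn (by linarith : (0 : ℝ) ≤ 1 - a')
    have hne : (1 - a') ≠ 0 := by linarith
    rwa [← Real.rpow_mul hTpos.le, show e * (1 - a') = 1 by
      rw [he, one_div, inv_mul_cancel₀ hne], Real.rpow_one] at h
  have hC' : C = 3 / 1000 * T := by rw [hT]; field_simp
  calc C * (n : ℝ) ^ a' = 3 / 1000 * (T * (n : ℝ) ^ a') := by rw [hC']; ring
    _ ≤ 3 / 1000 * ((n : ℝ) ^ (1 - a') * (n : ℝ) ^ a') := by gcongr
    _ = 3 / 1000 * n := by rw [← Real.rpow_add hnpos, sub_add_cancel, Real.rpow_one]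



/-! ## The engine: Diaz's theorem beats every exponent `a < 1` along a single transcendental slot -/

set_option maxHeartbeats 800000 in
/-- **Diaz's theorem kills every exponent `a < 1` at `θ = (1,…,1, e,…,e) ∈ ℂ²ᵐ` (every `m`; for `m = 0` trivially).**
For `s = (1, …, 1)` and any `a < 1`, `b`, `C > 0`, the challengers `γ = (1,…,1, α,…,α)` with `α` the
algebraic approximation of `e` of degree `≤ n` and Mahler measure `≤ M` from Bugeaud 2004 Thm 8.11
(= Diaz 1997; `Bugeaud2004_thm_8_11_holds`, PROVED in tree) beat the bound `exp(−C(dᵃ log H + dᵇ))`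
with budget `d := n`, `H := H(minpoly α) ≤ 2ⁿ M(α)`: the quality `0.006(n log M(α) + deg α · log M)`
is linear in `n` (choose `n` with `C n^{max a 0} ≤ 0.003 n`) and `M` is free at fixed `n`
(choose `log M > C(n^{1+a} log 2 + nᵇ)/0.006`). [cite: Bugeaud2004, Thm 8.11] -/
theorem not_approxTypeAt_const_one (m : ℕ) (a b C : ℝ) (ha : a < 1) :
    ¬ ApproxTypeAt m (fun _ => (1 : ℂ)) a b C := by
  rintro ⟨hC, hall⟩
  -- nonnegative exponents dominate
  set a' : ℝ := max a 0 with ha'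
  set b' : ℝ := max b 0 with hb'
  have ha'1 : a' < 1 := max_lt ha one_pos
  obtain ⟨n, hn50, hn⟩ := exists_deg a' C ha'1 hC
  have hn1nat : 1 ≤ n := le_trans (by norm_num) hn50
  have hn1 : (1 : ℝ) ≤ n := by exact_mod_cast hn1nat
  have hnpos : (0 : ℝ) < n := by linarith
  -- the M-independent slack and the choice of M
  set K0 : ℝ := C * ((n : ℝ) ^ a' * (n * Real.log 2) + (n : ℝ) ^ b') with hK0
  set ξ : ℂ := Complex.exp 1 with hξ
  set M : ℝ := max (max ((n : ℝ) + 1) ((4 + ‖ξ‖) ^ 100)) (Real.exp (K0 / (6 / 1000) + 1))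
    with hMdef
  have hM1 : (n : ℝ) + 1 ≤ M := (le_max_left _ _).trans (le_max_left _ _)
  have hM2 : (4 + ‖ξ‖) ^ 100 ≤ M := (le_max_right _ _).trans (le_max_left _ _)
  have hMpos : 0 < M := by linarith
  have hlogM : K0 / (6 / 1000) + 1 ≤ Real.log M := by
    rw [Real.le_log_iff_exp_le hMpos]
    exact le_max_right _ _
  -- Diaz / Bugeaud 8.11 at ξ = e
  obtain ⟨α, P, hPirr, hPα, hPdeg, hPM, hdist⟩ := Bugeaud2004_thm_8_11_holds ξ n M hn50 hM1 hM2
  have hP0 : P ≠ 0 := hPirr.ne_zero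
  have hdP : 1 ≤ P.natDegree := by
    rw [Nat.one_le_iff_ne_zero]
    intro h0
    have hc : P = Polynomial.C (P.coeff 0) := eq_C_of_natDegree_eq_zero h0
    rw [hc, aeval_C, algebraMap_int_eq, eq_intCast, Int.cast_eq_zero] at hPα
    exact hP0 (by rw [hc, hPα, map_zero])
  set MP : ℝ := (P.map (Int.castRingHom ℂ)).mahlerMeasure with hMP
  have hMP1 : 1 ≤ MP := one_le_mahlerMeasure_map P hP0
  have hlogMP : 0 ≤ Real.log MP := Real.log_nonneg hMP1
  -- the challenger γ = (1, 1, α, α) with budget d := n, H := natHeight P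
  set H : ℕ := natHeight P with hHdef
  have hH1 : 1 ≤ H := one_le_natHeight P hP0
  have hH1r : (1 : ℝ) ≤ H := by exact_mod_cast hH1
  set γ : Fin m ⊕ Fin m → ℂ := Sum.elim (fun _ => (1 : ℂ)) (fun _ => α) with hγ
  have hαint : IsIntegral ℚ α := by
    refine (show IsAlgebraic ℚ α from ⟨P.map (Int.castRingHom ℚ), ?_, ?_⟩).isIntegral
    · exact (Polynomial.map_ne_zero_iff (Int.castRingHom ℚ).injective_int).mpr hP0
    · rw [← algebraMap_int_eq, aeval_map_algebraMap]; exact hPα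
  have hfr : Module.finrank ℚ ↥(IntermediateField.adjoin ℚ (Set.range γ)) ≤ n := by
    have hle : IntermediateField.adjoin ℚ (Set.range γ) ≤ IntermediateField.adjoin ℚ {α} := by
      rw [IntermediateField.adjoin_le_iff]
      rintro _ ⟨i, rfl⟩
      rcases i with i | i
      · have : γ (Sum.inl i) = 1 := by simp [hγ]
        rw [this]; exact one_mem _
      · have : γ (Sum.inr i) = α := by simp [hγ]
        rw [this]; exact IntermediateField.mem_adjoin_simple_self ℚ α
    haveI : FiniteDimensional ℚ (IntermediateField.adjoin ℚ {α}) :=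
      IntermediateField.adjoin.finiteDimensional hαint
    refine (IntermediateField.finrank_le_of_le_right hle).trans ?_
    rw [IntermediateField.adjoin.finrank hαint]
    refine le_trans ?_ hPdeg
    have h := minpoly.degree_le_of_ne_zero ℚ α
      ((Polynomial.map_ne_zero_iff (Int.castRingHom ℚ).injective_int).mpr hP0)
      (by rw [← algebraMap_int_eq, aeval_map_algebraMap]; exact hPα)
    have h' := natDegree_le_natDegree h
    rwa [natDegree_map_eq_of_injective (Int.castRingHom ℚ).injective_int] at h'
  have hcl : ∀ i, ∃ Q : Polynomial ℤ, Q ≠ 0 ∧ Q.natDegree ≤ n ∧ (∀ k, |Q.coeff k| ≤ (H : ℤ)) ∧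
      Polynomial.aeval (γ i) Q = 0 := by
    rintro (i | i)
    · refine ⟨X - Polynomial.C 1, X_sub_C_ne_zero 1, ?_, ?_, ?_⟩
      · rw [natDegree_X_sub_C]; exact hn1nat
      · intro k
        have hH1z : (1 : ℤ) ≤ H := by exact_mod_cast hH1
        rw [coeff_sub, coeff_X, coeff_C]
        split_ifs <;> simp <;> omega
      · have : γ (Sum.inl i) = 1 := by simp [hγ]
        simp [this]
    · refine ⟨P, hP0, hPdeg, abs_coeff_le_natHeight P, ?_⟩
      have : γ (Sum.inr i) = α := by simp [hγ]
      rw [this]; exact hPα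
  have key := hall n H γ hfr hcl
  -- the distance is |e - α|
  have hdist' : ‖γ - Sum.elim (fun _ : Fin m => (1 : ℂ)) (Complex.exp ∘ fun _ : Fin m => (1 : ℂ))‖ ≤
      ‖ξ - α‖ := by
    refine (pi_norm_le_iff_of_nonneg (norm_nonneg _)).mpr ?_
    rintro (i | i)
    · simp [hγ]
    · simp [hγ, hξ, norm_sub_rev]
  -- height bookkeeping: log H ≤ n log 2 + log M(P)
  have hlogH : Real.log H ≤ n * Real.log 2 + Real.log MP := by
    have h1 : (H : ℝ) ≤ 2 ^ P.natDegree * MP := natHeight_le P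
    have h2 : (2 : ℝ) ^ P.natDegree ≤ 2 ^ n := pow_le_pow_right₀ (by norm_num) hPdeg
    have h3 : (H : ℝ) ≤ 2 ^ n * MP := h1.trans (by gcongr)
    calc Real.log H ≤ Real.log (2 ^ n * MP) := Real.log_le_log (by positivity) h3
      _ = n * Real.log 2 + Real.log MP := by
        rw [Real.log_mul (by positivity) (by positivity), Real.log_pow]
  -- exponent bookkeeping
  have hna : (n : ℝ) ^ a ≤ (n : ℝ) ^ a' := Real.rpow_le_rpow_of_exponent_le hn1 (le_max_left _ _)
  have hnb : (n : ℝ) ^ b ≤ (n : ℝ) ^ b' := Real.rpow_le_rpow_of_exponent_le hn1 (le_max_left _ _)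
  have hlogH0 : 0 ≤ Real.log H := Real.log_nonneg hH1r
  have hna'0 : 0 ≤ (n : ℝ) ^ a' := by positivity
  have hLHS : C * ((n : ℝ) ^ a * Real.log H + (n : ℝ) ^ b) ≤
      3 / 1000 * ((n : ℝ) * Real.log MP) + K0 := by
    have step : C * (n : ℝ) ^ a' * Real.log MP ≤ 3 / 1000 * n * Real.log MP :=
      mul_le_mul_of_nonneg_right hn hlogMP
    calc C * ((n : ℝ) ^ a * Real.log H + (n : ℝ) ^ b)
        ≤ C * ((n : ℝ) ^ a' * Real.log H + (n : ℝ) ^ b') := by gcongr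
      _ ≤ C * ((n : ℝ) ^ a' * (n * Real.log 2 + Real.log MP) + (n : ℝ) ^ b') := by gcongr
      _ = C * (n : ℝ) ^ a' * Real.log MP + K0 := by rw [hK0]; ring
      _ ≤ 3 / 1000 * n * Real.log MP + K0 := by linarith
      _ = 3 / 1000 * ((n : ℝ) * Real.log MP) + K0 := by ring
  have hKM : K0 < 6 / 1000 * Real.log M := by
    have h6 : (6 / 1000 : ℝ) * (K0 / (6 / 1000)) = K0 := by field_simp
    have h := mul_le_mul_of_nonneg_left hlogM (by norm_num : (0 : ℝ) ≤ 6 / 1000)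
    rw [mul_add, h6] at h
    linarith
  have hX0 : 0 ≤ (n : ℝ) * Real.log MP := by positivity
  have hlM : 0 ≤ Real.log M := by
    have hK0nn : 0 ≤ K0 := by rw [hK0]; positivity
    linarith
  have hY : Real.log M ≤ (P.natDegree : ℝ) * Real.log M :=
    le_mul_of_one_le_left hlM (by exact_mod_cast hdP)
  have hgap : C * ((n : ℝ) ^ a * Real.log H + (n : ℝ) ^ b) <
      6 / 1000 * ((n : ℝ) * Real.log MP + (P.natDegree : ℝ) * Real.log M) := by
    linarith
  -- contradiction
  have hchain : Real.exp (-(C * ((n : ℝ) ^ a * Real.log H + (n : ℝ) ^ b))) ≤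
      Real.exp (-(6 / 1000 * ((n : ℝ) * Real.log MP + (P.natDegree : ℝ) * Real.log M))) :=
    key.trans (hdist'.trans hdist)
  rw [Real.exp_le_exp] at hchain
  linarith


/-! ## (a) Load-bearing hypotheses -/

/-- The crux with `2 ≤ n` DROPPED. -/
def KhovanskiiApproxTypeWithoutTwoLe : Prop :=
  ∀ (n : ℕ) (s : Fin n → ℂ), LinearIndependent ℚ s →
    IsFreeKhovanskii n s → ∃ a b C : ℝ, a < 1 / ((n : ℝ) - 1) ∧ ApproxTypeAt n s a b C

/-- The crux with `2 ≤ n` WEAKENED to `1 ≤ n`. -/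
def KhovanskiiApproxTypeFromOne : Prop :=
  ∀ (n : ℕ) (s : Fin n → ℂ), 1 ≤ n → LinearIndependent ℚ s →
    IsFreeKhovanskii n s → ∃ a b C : ℝ, a < 1 / ((n : ℝ) - 1) ∧ ApproxTypeAt n s a b C

/-- The crux with `LinearIndependent ℚ s` DROPPED. -/
def KhovanskiiApproxTypeWithoutLinIndep : Prop :=
  ∀ (n : ℕ) (s : Fin n → ℂ), 2 ≤ n →
    IsFreeKhovanskii n s → ∃ a b C : ℝ, a < 1 / ((n : ℝ) - 1) ∧ ApproxTypeAt n s a b C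

/-- The crux with the Khovanskii system (`IsFreeKhovanskii`) DROPPED. -/
def KhovanskiiApproxTypeWithoutKhovanskii : Prop :=
  ∀ (n : ℕ) (s : Fin n → ℂ), 2 ≤ n → LinearIndependent ℚ s →
    ∃ a b C : ℝ, a < 1 / ((n : ℝ) - 1) ∧ ApproxTypeAt n s a b C

/-- Sanity: the four variants re-assemble the crux (each hypothesis restored). -/
theorem khovanskiiApproxType_of_without (h : KhovanskiiApproxTypeWithoutLinIndep) :
    KhovanskiiApproxType :=
  khovanskiiApproxType_iff.mpr fun n s hn _ hK => h n s hn hK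

/-- The constant tuple `s = (1, …, 1) ∈ ℂⁿ` is a non-degenerate zero of the Khovanskii system
`zᵢ − 1 = 0`: the exponential Jacobian is the identity matrix. (For `n ≥ 2` it is ℚ-linearly
DEPENDENT; for `n = 1` it is the Hermite–Lindemann point `θ = (1, e)`; for `n = 0` it is empty.) -/
theorem isFreeKhovanskii_const_one (n : ℕ) : IsFreeKhovanskii n (fun _ => (1 : ℂ)) := by
  classical
  refine ⟨fun i => MvPolynomial.X (Sum.inl i) - 1, ?_, ?_⟩
  · intro i
    simp
  · have : (Matrix.of fun i j => MvPolynomial.aeval (Sum.elim (fun _ : Fin n => (1 : ℂ))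
        (Complex.exp ∘ fun _ : Fin n => (1 : ℂ)))
        (MvPolynomial.pderiv (Sum.inl j) (MvPolynomial.X (Sum.inl i) - 1) +
          MvPolynomial.X (Sum.inr j) *
            MvPolynomial.pderiv (Sum.inr j) (MvPolynomial.X (Sum.inl i) - 1 :
              MvPolynomial (Fin n ⊕ Fin n) ℚ))) = 1 := by
      ext i j
      by_cases hij : i = j
      · subst hij; simp [MvPolynomial.pderiv_X, Pi.single_apply]
      · simp [MvPolynomial.pderiv_X, Pi.single_apply, hij]
    rw [this, Matrix.det_one]
    exact one_ne_zero

/-- At `n = 0` no approximation type exists at all: the (unique, empty) challenger `γ = θ = ()`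
is admissible with `d = H = 1` and has distance `0 < exp(−C(1ᵃ·0 + 1ᵇ))`. [folklore] -/
theorem not_approxTypeAt_zero (s : Fin 0 → ℂ) (a b C : ℝ) : ¬ ApproxTypeAt 0 s a b C := by
  rintro ⟨-, h⟩
  have h1 := h 1 1 (fun _ => 0) ?_ ?_
  · have : ‖(fun _ : Fin 0 ⊕ Fin 0 => (0 : ℂ)) - Sum.elim s (Complex.exp ∘ s)‖ = 0 := by
      rw [norm_eq_zero]; exact Subsingleton.elim _ _
    rw [this] at h1
    exact absurd h1 (not_le.mpr (Real.exp_pos _))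
  · have hr : Set.range (fun _ : Fin 0 ⊕ Fin 0 => (0 : ℂ)) = ∅ := Set.range_eq_empty _
    rw [hr, IntermediateField.adjoin_empty, IntermediateField.finrank_bot]
  · intro i; exact (IsEmpty.false i).elim

/-- **`2 ≤ n` is load-bearing (trivially): with it dropped the crux fails at `n = 0`.** -/
theorem khovanskiiApproxType_false_without_twoLe : ¬ KhovanskiiApproxTypeWithoutTwoLe := by
  intro h
  obtain ⟨a, b, C, -, hAT⟩ := h 0 (fun _ => 1) linearIndependent_empty_type
    (isFreeKhovanskii_const_one 0)
  exact not_approxTypeAt_zero _ a b C hAT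

/-- **`2 ≤ n` cannot be weakened to `1 ≤ n`:** at the Hermite–Lindemann point `s = (1)` the typed
exponent bound is `a < 1/((1:ℝ) − 1) = 0 < 1`, and Diaz beats every `a < 1` (so the failure is
not only the `1/0 = 0` junk: the informal `n = 1` statement "some `a < 1`" is false too). -/
theorem khovanskiiApproxType_false_from_one : ¬ KhovanskiiApproxTypeFromOne := by
  intro h
  have hli : LinearIndependent ℚ (fun _ : Fin 1 => (1 : ℂ)) := by
    rw [linearIndependent_unique_iff]; exact one_ne_zero
  obtain ⟨a, b, C, ha, hAT⟩ := h 1 (fun _ => 1) le_rfl hli (isFreeKhovanskii_const_one 1)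
  have ha1 : a < 1 := by norm_num at ha; linarith
  exact not_approxTypeAt_const_one 1 a b C ha1 hAT

/-- **`LinearIndependent ℚ s` is load-bearing:** with it dropped the crux fails at `n = 2`,
`s = (1, 1)` (a non-degenerate zero of `z₁ − 1 = z₂ − 1 = 0`), `θ = (1, 1, e, e)`: every `a < 1`
is beaten by the diagonal challengers `(1, 1, α, α)` of Diaz's theorem. ANY PROOF of the crux must
use linear independence — and use it to produce two independent transcendental directions among
the coordinates of `θ` (one direction always loses to Diaz). -/
theorem khovanskiiApproxType_false_without_linIndep : ¬ KhovanskiiApproxTypeWithoutLinIndep := by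
  intro h
  obtain ⟨a, b, C, ha, hAT⟩ := h 2 (fun _ => 1) le_rfl (isFreeKhovanskii_const_one 2)
  have ha1 : a < 1 := by norm_num at ha; linarith
  exact not_approxTypeAt_const_one 2 a b C ha1 hAT

/-! ## (b) Tightness: the constants are not uniform in the point -/

/-- Khovanskii data for `s = (x, √2·x)`, `x > 0` real with `k·x·eˣ = 1` (`k ≥ 1`): the system
`k z₁ y₁ − 1 = 0`, `z₂² − 2 z₁² = 0` has exponential Jacobian `[[k y₁(1+z₁), 0], [−4z₁, 2z₂]]`,
determinant `2√2·k·x(1+x)eˣ ≠ 0`. -/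
theorem isFreeKhovanskii_lambert (k : ℕ) (hk : 1 ≤ k) (x : ℝ) (hx : (k : ℝ) * x * Real.exp x = 1)
    (hx0 : 0 < x) : IsFreeKhovanskii 2 ![(x : ℂ), ((Real.sqrt 2 * x : ℝ) : ℂ)] := by
  classical
  have hxC : (k : ℂ) * (x : ℂ) * Complex.exp (x : ℂ) = 1 := by
    rw [← Complex.ofReal_exp]; exact_mod_cast hx
  have hk0 : (k : ℂ) ≠ 0 := by exact_mod_cast (show k ≠ 0 by omega)
  have hx0C : (x : ℂ) ≠ 0 := by exact_mod_cast hx0.ne'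
  have hx1C : (x : ℂ) + 1 ≠ 0 := by
    have : (x + 1 : ℝ) ≠ 0 := by linarith
    exact_mod_cast this
  have hs2 : ((Real.sqrt 2 : ℝ) : ℂ) ^ 2 = 2 := by
    rw [← Complex.ofReal_pow, Real.sq_sqrt (by norm_num : (0 : ℝ) ≤ 2)]; push_cast; rfl
  have hs0 : ((Real.sqrt 2 : ℝ) : ℂ) ≠ 0 := by
    exact_mod_cast (Real.sqrt_pos.mpr (by norm_num : (0:ℝ) < 2)).ne'
  refine ⟨![MvPolynomial.C (k : ℚ) * MvPolynomial.X (Sum.inl 0) * MvPolynomial.X (Sum.inr 0) - 1,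
    MvPolynomial.X (Sum.inl 1) ^ 2 - MvPolynomial.C (2 : ℚ) * MvPolynomial.X (Sum.inl 0) ^ 2], ?_, ?_⟩
  · intro i
    fin_cases i
    · simp [hxC]
    · simp
      rw [mul_pow, hs2]; ring
  · rw [Matrix.det_fin_two]
    simp [Matrix.of_apply, MvPolynomial.pderiv_X, Derivation.leibniz]
    refine ⟨?_, ?_⟩
    · have : Complex.exp ↑x * ↑k + Complex.exp ↑x * (↑k * ↑x) = ↑k * Complex.exp ↑x * (↑x + 1) := by
        ring
      rw [this]
      exact mul_ne_zero (mul_ne_zero hk0 (Complex.exp_ne_zero _)) hx1C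
    · exact hx0.ne'

/-- `(x, √2 x)` is ℚ-linearly independent for real `x ≠ 0` (irrationality of `√2`). -/
theorem linearIndependent_lambert (x : ℝ) (hx0 : x ≠ 0) :
    LinearIndependent ℚ ![(x : ℂ), ((Real.sqrt 2 * x : ℝ) : ℂ)] := by
  rw [LinearIndependent.pair_iff]
  intro s t hst
  have h1 : ((s : ℝ) + (t : ℝ) * Real.sqrt 2) * x = 0 := by
    have : ((((s : ℝ) + (t : ℝ) * Real.sqrt 2) * x : ℝ) : ℂ) = 0 := by
      push_cast
      rw [Rat.smul_def, Rat.smul_def] at hst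
      push_cast at hst
      linear_combination hst
    exact_mod_cast this
  have h2 : (s : ℝ) + (t : ℝ) * Real.sqrt 2 = 0 := by
    rcases mul_eq_zero.mp h1 with h | h
    · exact h
    · exact absurd h hx0
  by_cases ht : t = 0
  · subst ht
    simp at h2
    exact ⟨by exact_mod_cast h2, rfl⟩
  · exfalso
    have : Real.sqrt 2 = ((-s / t : ℚ) : ℝ) := by
      have ht' : (t : ℝ) ≠ 0 := by exact_mod_cast ht
      push_cast
      field_simp
      linarith
    exact irrational_sqrt_two.ne_rat _ this

/-- For `k ≥ 1` the equation `k x eˣ = 1` has a root `0 < x ≤ 1/k` (intermediate value theorem). -/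
theorem exists_lambert (k : ℕ) (hk : 1 ≤ k) :
    ∃ x : ℝ, 0 < x ∧ x ≤ 1 / k ∧ (k : ℝ) * x * Real.exp x = 1 := by
  have hk' : (1 : ℝ) ≤ k := by exact_mod_cast hk
  have hcont : ContinuousOn (fun x : ℝ => (k : ℝ) * x * Real.exp x) (Set.Icc 0 1) := by
    fun_prop
  have h0 : (fun x : ℝ => (k : ℝ) * x * Real.exp x) 0 ≤ 1 := by simp
  have h1 : (1 : ℝ) ≤ (fun x : ℝ => (k : ℝ) * x * Real.exp x) 1 := by
    simp only [mul_one]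
    nlinarith [Real.add_one_le_exp (1 : ℝ)]
  obtain ⟨x, ⟨hx0, hx1⟩, hx⟩ :=
    intermediate_value_Icc (zero_le_one) hcont ⟨h0, h1⟩
  simp only at hx
  have hxpos : 0 < x := by
    rcases hx0.lt_or_eq with h | h
    · exact h
    · subst h; simp at hx
  refine ⟨x, hxpos, ?_, hx⟩
  rw [div_eq_mul_inv, one_mul, le_inv_comm₀ hxpos (by linarith)]
  -- k ≤ 1/x  since  1 = k x eˣ ≥ k x
  rw [inv_eq_one_div, le_div_iff₀ hxpos]
  nlinarith [Real.add_one_le_exp x, mul_nonneg (by linarith : (0:ℝ) ≤ k) hxpos.le]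

/-- The crux with constants UNIFORM in the point (natural strengthening). -/
def KhovanskiiApproxTypeUniform : Prop :=
  ∀ n : ℕ, 2 ≤ n → ∃ a b C : ℝ, a < 1 / ((n : ℝ) - 1) ∧
    ∀ s : Fin n → ℂ, LinearIndependent ℚ s → IsFreeKhovanskii n s → ApproxTypeAt n s a b C

set_option maxHeartbeats 400000 in
/-- **The constants `(a, b, C)` cannot be chosen uniformly in the point** (tightness): the free
Khovanskii points `s_k = (x_k, √2 x_k)`, `k x_k e^{x_k} = 1` (`0 < x_k ≤ 1/k`), accumulate at the
ALGEBRAIC point `(0, 0, 1, 1)`, an admissible challenger with `d = H = 1`, whose distance to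
`θ_k = (x_k, √2 x_k, e^{x_k}, e^{√2 x_k})` is `≤ 2√2/k < e^{−C}` for large `k`. [folklore] -/
theorem not_khovanskiiApproxTypeUniform : ¬ KhovanskiiApproxTypeUniform := by
  intro h
  obtain ⟨a, b, C, -, hall⟩ := h 2 le_rfl
  -- the constant C of the uniform type (positivity is part of ApproxTypeAt at any point)
  set k : ℕ := ⌈3 * Real.exp C⌉₊ + 2 with hkdef
  have hk1 : 1 ≤ k := by omega
  have hk2 : (2 : ℝ) ≤ k := by exact_mod_cast (show 2 ≤ k by omega)
  have hkC : 3 * Real.exp C < k := by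
    have := Nat.le_ceil (3 * Real.exp C)
    have h' : (⌈3 * Real.exp C⌉₊ : ℝ) + 2 = (k : ℝ) := by rw [hkdef]; push_cast; ring
    linarith
  obtain ⟨x, hx0, hxk, hx⟩ := exists_lambert k hk1
  obtain ⟨hC, hAT⟩ := hall _ (linearIndependent_lambert x hx0.ne') (isFreeKhovanskii_lambert k hk1 x hx hx0)
  -- challenger (0,0,1,1), budget d = H = 1
  have key := hAT 1 1 (Sum.elim ![0, 0] ![1, 1]) ?_ ?_
  · -- distance bound
    have hkpos : (0 : ℝ) < k := by linarith
    have hx1 : x ≤ 1 := hxk.trans (by rw [div_le_one hkpos]; linarith)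
    have hsx : Real.sqrt 2 * x ≤ Real.sqrt 2 / k := by
      rw [div_eq_mul_one_div]; exact mul_le_mul_of_nonneg_left hxk (Real.sqrt_nonneg _)
    have hs2 : Real.sqrt 2 < 3 / 2 := by
      rw [Real.sqrt_lt' (by norm_num)]; norm_num
    have hs1 : 1 < Real.sqrt 2 := by
      rw [Real.lt_sqrt (by norm_num)]; norm_num
    have hsxpos : 0 < Real.sqrt 2 * x := by positivity
    have hsx1 : Real.sqrt 2 * x ≤ 1 := by
      calc Real.sqrt 2 * x ≤ Real.sqrt 2 / k := hsx
        _ ≤ Real.sqrt 2 / 2 := by gcongr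
        _ ≤ 1 := by linarith
    have hbound : ‖Sum.elim ![(0 : ℂ), 0] ![1, 1] -
        Sum.elim ![(x : ℂ), ((Real.sqrt 2 * x : ℝ) : ℂ)]
          (Complex.exp ∘ ![(x : ℂ), ((Real.sqrt 2 * x : ℝ) : ℂ)])‖ ≤ 2 * (Real.sqrt 2 / k) := by
      refine (pi_norm_le_iff_of_nonneg (by positivity)).mpr ?_
      have e1 : |Real.exp x - 1| ≤ 2 * |x| := Real.abs_exp_sub_one_le (by rw [abs_of_pos hx0]; exact hx1)
      have e2 : |Real.exp (Real.sqrt 2 * x) - 1| ≤ 2 * |Real.sqrt 2 * x| :=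
        Real.abs_exp_sub_one_le (by rw [abs_of_pos hsxpos]; exact hsx1)
      rw [abs_of_pos hx0] at e1
      rw [abs_of_pos hsxpos] at e2
      rintro (i | i) <;> fin_cases i
      · simp only [Pi.sub_apply, Sum.elim_inl]
        simp
        rw [abs_of_pos hx0]
        nlinarith
      · simp only [Pi.sub_apply, Sum.elim_inl]
        simp
        rw [abs_of_pos (Real.sqrt_pos.mpr (by norm_num : (0:ℝ) < 2)), abs_of_pos hx0]
        have : 0 ≤ Real.sqrt 2 / k := by positivity
        linarith
      · simp only [Pi.sub_apply, Sum.elim_inr, Function.comp]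
        simp
        rw [← Complex.ofReal_exp, ← Complex.ofReal_one, ← Complex.ofReal_sub, Complex.norm_real,
          Real.norm_eq_abs, abs_sub_comm]
        nlinarith
      · simp only [Pi.sub_apply, Sum.elim_inr, Function.comp]
        simp
        rw [← Complex.ofReal_mul, ← Complex.ofReal_exp, ← Complex.ofReal_one, ← Complex.ofReal_sub,
          Complex.norm_real, Real.norm_eq_abs, abs_sub_comm]
        linarith
    have hlhs : Real.exp (-(C * (((1:ℕ) : ℝ) ^ a * Real.log ((1:ℕ):ℝ) + ((1:ℕ) : ℝ) ^ b))) = Real.exp (-C) := by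
      simp
    rw [hlhs] at key
    have hfin : 2 * (Real.sqrt 2 / k) < Real.exp (-C) := by
      have h3k : 3 / (k : ℝ) < Real.exp (-C) := by
        rw [Real.exp_neg, ← one_div, div_lt_div_iff₀ hkpos (Real.exp_pos C)]
        linarith
      have h22 : 2 * (Real.sqrt 2 / k) < 3 / (k : ℝ) := by
        rw [show 2 * (Real.sqrt 2 / k) = (2 * Real.sqrt 2) / (k : ℝ) by ring]
        exact div_lt_div_of_pos_right (by linarith) hkpos
      linarith
    linarith [key.trans hbound]
  · -- finrank: adjoin {0,1} = ⊥
    have : IntermediateField.adjoin ℚ (Set.range (Sum.elim ![(0:ℂ), 0] ![1, 1])) = ⊥ := by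
      rw [← le_bot_iff, IntermediateField.adjoin_le_iff]
      rintro _ ⟨i, rfl⟩
      rcases i with i | i <;> fin_cases i
      · exact zero_mem _
      · exact zero_mem _
      · exact one_mem _
      · exact one_mem _
    rw [this, IntermediateField.finrank_bot]
  · rintro (i | i) <;> fin_cases i
    · exact ⟨X, X_ne_zero, by simp, fun k => by rw [coeff_X]; split_ifs <;> simp, by simp⟩
    · exact ⟨X, X_ne_zero, by simp, fun k => by rw [coeff_X]; split_ifs <;> simp, by simp⟩
    · refine ⟨X - Polynomial.C 1, X_sub_C_ne_zero 1, by rw [natDegree_X_sub_C], fun k => ?_, by simp⟩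
      rw [coeff_sub, coeff_X, coeff_C]; split_ifs <;> simp
    · refine ⟨X - Polynomial.C 1, X_sub_C_ne_zero 1, by rw [natDegree_X_sub_C], fun k => ?_, by simp⟩
      rw [coeff_sub, coeff_X, coeff_C]; split_ifs <;> simp


/-! ## (a′) The Khovanskii system is load-bearing: the ultra-Liouville witness `s = (log 2, r·log 2)` -/

/-! ### The tower `t` and the number `r = ∑ 10^{-t_j}` -/

namespace Tower

/-- The tower `t 0 = 1`, `t (k+1) = 10 ^ ((k+1)^2 · t k)`. -/
def t : ℕ → ℕ
  | 0 => 1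
  | k + 1 => 10 ^ ((k + 1) ^ 2 * t k)

theorem t_zero : t 0 = 1 := rfl

theorem t_succ (k : ℕ) : t (k + 1) = 10 ^ ((k + 1) ^ 2 * t k) := rfl

theorem one_le_t (k : ℕ) : 1 ≤ t k := by
  cases k with
  | zero => simp [t]
  | succ k => rw [t_succ]; exact Nat.one_le_pow _ _ (by norm_num)

theorem lt_t_succ (k : ℕ) : (k + 1) ^ 2 * t k < t (k + 1) := by
  rw [t_succ]; exact Nat.lt_pow_self (by norm_num)

theorem t_lt_t_succ (k : ℕ) : t k < t (k + 1) :=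
  lt_of_le_of_lt (Nat.le_mul_of_pos_left _ (by positivity)) (lt_t_succ k)

theorem t_strictMono : StrictMono t := strictMono_nat_of_lt_succ t_lt_t_succ

theorem t_mono : Monotone t := t_strictMono.monotone

theorem succ_le_t (k : ℕ) : k + 1 ≤ t k := by
  induction k with
  | zero => simp [t]
  | succ k ih => have := t_lt_t_succ k; omega

theorem t_add_le (k j : ℕ) : t k + j ≤ t (k + j) := by
  induction j with
  | zero => simp
  | succ j ih =>
    have := t_lt_t_succ (k + j)
    show t k + (j + 1) ≤ t (k + j + 1)
    omega

/-- the terms `(1/10)^(t j)` -/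
def term (j : ℕ) : ℝ := (1 / 10 : ℝ) ^ t j

theorem term_pos (j : ℕ) : 0 < term j := by unfold term; positivity

theorem term_le_geom (j : ℕ) : term j ≤ (1 / 10 : ℝ) * (1 / 10 : ℝ) ^ j := by
  unfold term
  rw [← pow_succ']
  exact pow_le_pow_of_le_one (by norm_num) (by norm_num) (succ_le_t j)

theorem summable_geom : Summable (fun j : ℕ => (1 / 10 : ℝ) * (1 / 10 : ℝ) ^ j) :=
  (summable_geometric_of_lt_one (by norm_num) (by norm_num)).mul_left _

theorem summable_term : Summable term :=
  Summable.of_nonneg_of_le (fun j => (term_pos j).le) term_le_geom summable_geom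

/-- the ultra-Liouville number `r = ∑ (1/10)^(t j)` -/
def r : ℝ := ∑' j, term j

/-- partial sums -/
def rpart (k : ℕ) : ℝ := ∑ j ∈ Finset.range (k + 1), term j

/-- numerators `p k = ∑_{j ≤ k} 10^(t k − t j)` -/
def pnum (k : ℕ) : ℕ := ∑ j ∈ Finset.range (k + 1), 10 ^ (t k - t j)

theorem rpart_eq (k : ℕ) : rpart k = (pnum k : ℝ) / (10 : ℝ) ^ t k := by
  unfold rpart pnum term
  push_cast
  rw [Finset.sum_div]
  refine Finset.sum_congr rfl fun j hj => ?_
  have hj' : t j ≤ t k := t_mono (by simpa [Nat.lt_succ_iff] using hj)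
  rw [one_div_pow, eq_div_iff (by positivity), one_div, inv_mul_eq_iff_eq_mul₀ (by positivity),
    ← pow_add, Nat.add_sub_cancel' hj']

theorem one_le_pnum (k : ℕ) : 1 ≤ pnum k := by
  unfold pnum
  calc 1 = 10 ^ (t k - t k) := by simp
    _ ≤ ∑ j ∈ Finset.range (k + 1), 10 ^ (t k - t j) :=
      Finset.single_le_sum (f := fun j => 10 ^ (t k - t j)) (fun _ _ => Nat.zero_le _)
        (Finset.self_mem_range_succ k)

theorem tail_summable (k : ℕ) : Summable (fun j => term (j + (k + 1))) :=
  (summable_nat_add_iff (k + 1)).mpr summable_term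

theorem tail_eq (k : ℕ) : r - rpart k = ∑' j, term (j + (k + 1)) := by
  unfold r rpart
  rw [← Summable.sum_add_tsum_nat_add (k + 1) summable_term]
  ring

theorem tail_pos (k : ℕ) : 0 < r - rpart k := by
  rw [tail_eq]
  exact (tail_summable k).tsum_pos (fun j => (term_pos _).le) 0 (term_pos _)

theorem tail_le (k : ℕ) : r - rpart k ≤ 2 * (1 / 10 : ℝ) ^ t (k + 1) := by
  rw [tail_eq]
  have hle : ∀ j, term (j + (k + 1)) ≤ (1 / 10 : ℝ) ^ t (k + 1) * (1 / 10 : ℝ) ^ j := by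
    intro j
    unfold term
    rw [← pow_add]
    apply pow_le_pow_of_le_one (by norm_num) (by norm_num)
    have := t_add_le (k + 1) j
    rw [add_comm j]; exact this
  have hsg : Summable (fun j : ℕ => (1 / 10 : ℝ) ^ t (k + 1) * (1 / 10 : ℝ) ^ j) :=
    (summable_geometric_of_lt_one (by norm_num) (by norm_num)).mul_left _
  calc ∑' j, term (j + (k + 1)) ≤ ∑' j, (1 / 10 : ℝ) ^ t (k + 1) * (1 / 10 : ℝ) ^ j :=
        (tail_summable k).tsum_le_tsum hle hsg
    _ = (1 / 10 : ℝ) ^ t (k + 1) * (1 - 1 / 10)⁻¹ := by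
        rw [tsum_mul_left, tsum_geometric_of_lt_one (by norm_num) (by norm_num)]
    _ ≤ 2 * (1 / 10 : ℝ) ^ t (k + 1) := by
        rw [mul_comm]; gcongr; norm_num

theorem r_le : r ≤ 1 / 9 := by
  unfold r
  calc ∑' j, term j ≤ ∑' j, (1 / 10 : ℝ) * (1 / 10 : ℝ) ^ j :=
        summable_term.tsum_le_tsum term_le_geom summable_geom
    _ = (1 / 10 : ℝ) * (1 - 1 / 10)⁻¹ := by
        rw [tsum_mul_left, tsum_geometric_of_lt_one (by norm_num) (by norm_num)]
    _ = 1 / 9 := by norm_num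

theorem rpart_pos (k : ℕ) : 0 < rpart k :=
  Finset.sum_pos (fun j _ => term_pos j) ⟨0, by simp⟩

theorem r_pos : 0 < r := by
  have := tail_pos 0; have := rpart_pos 0; linarith

theorem rpart_lt_r (k : ℕ) : rpart k < r := by have := tail_pos k; linarith

theorem pnum_lt (k : ℕ) : pnum k < 10 ^ t k := by
  have h : (pnum k : ℝ) / (10 : ℝ) ^ t k < 1 := by
    rw [← rpart_eq]; have := rpart_lt_r k; have := r_le; linarith
  rw [div_lt_one (by positivity)] at h
  exact_mod_cast h

theorem liouville_r : Liouville r := by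
  intro n
  have hq : (((10 ^ t n : ℕ) : ℤ) : ℝ) = (10 : ℝ) ^ t n := by push_cast; ring
  have hp : ((pnum n : ℤ) : ℝ) = (pnum n : ℝ) := by push_cast; ring
  have hpq : ((pnum n : ℤ) : ℝ) / (((10 ^ t n : ℕ) : ℤ) : ℝ) = rpart n := by
    rw [hp, hq, ← rpart_eq]
  refine ⟨(pnum n : ℤ), ((10 ^ t n : ℕ) : ℤ), ?_, ?_, ?_⟩
  · have : 10 ≤ 10 ^ t n := by
      calc 10 = 10 ^ 1 := by norm_num
        _ ≤ 10 ^ t n := Nat.pow_le_pow_right (by norm_num) (one_le_t n)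
    exact_mod_cast (show 1 < 10 ^ t n by omega)
  · rw [hpq]; exact (rpart_lt_r n).ne'
  · rw [hpq, abs_of_pos (tail_pos n)]
    have hexp : n * t n + 2 ≤ t (n + 1) := by
      have h1 := lt_t_succ n
      have h2 : n * t n + t n ≤ (n + 1) ^ 2 * t n := by
        have : n + 1 ≤ (n + 1) ^ 2 := Nat.le_self_pow (by norm_num) _
        calc n * t n + t n = (n + 1) * t n := by ring
          _ ≤ (n + 1) ^ 2 * t n := Nat.mul_le_mul_right _ this
      have h3 := one_le_t n
      omega
    have hX : (0 : ℝ) < ((10 : ℝ) ^ (n * t n))⁻¹ := by positivity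
    calc r - rpart n ≤ 2 * (1 / 10 : ℝ) ^ t (n + 1) := tail_le n
      _ ≤ 2 * (1 / 10 : ℝ) ^ (n * t n + 2) :=
          mul_le_mul_of_nonneg_left (pow_le_pow_of_le_one (by norm_num) (by norm_num) hexp)
            (by norm_num)
      _ < 1 / (((10 ^ t n : ℕ) : ℤ) : ℝ) ^ n := by
          rw [hq, ← pow_mul, pow_add, one_div_pow, mul_comm (t n) n]
          norm_num
          linarith

theorem irrational_r : Irrational r := liouville_r.irrational

end Tower

/-! ## Stage lemma for the Liouville witness: real-analysis pieces -/

/-- `2^r − 2^s ≤ 3 (r − s)` for `0 ≤ s ≤ r ≤ 1` (mean-value bound with `2 log 2 < 3/2`). [folklore] -/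
theorem two_rpow_sub_le {s r : ℝ} (hs : 0 ≤ s) (hsr : s ≤ r) (hr : r ≤ 1) :
    (2 : ℝ) ^ r - (2 : ℝ) ^ s ≤ 3 * (r - s) := by
  have hlog2 : Real.log 2 < 7 / 10 := by have := Real.log_two_lt_d9; linarith
  have hlog2pos : 0 < Real.log 2 := Real.log_pos (by norm_num)
  have hu : (2 : ℝ) ^ s = Real.exp (s * Real.log 2) := by rw [Real.rpow_def_of_pos two_pos, mul_comm]
  have hv : (2 : ℝ) ^ r = Real.exp (r * Real.log 2) := by rw [Real.rpow_def_of_pos two_pos, mul_comm]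
  have hvu0 : 0 ≤ (r - s) * Real.log 2 := mul_nonneg (by linarith) hlog2pos.le
  have hvu1 : (r - s) * Real.log 2 ≤ 1 := by
    have h1 : (r - s) * Real.log 2 ≤ (r - s) * 1 :=
      mul_le_mul_of_nonneg_left (by linarith) (by linarith)
    linarith
  rw [hu, hv]
  have hfact : Real.exp (r * Real.log 2) - Real.exp (s * Real.log 2) =
      Real.exp (s * Real.log 2) * (Real.exp ((r - s) * Real.log 2) - 1) := by
    rw [mul_sub, mul_one, ← Real.exp_add,
      show s * Real.log 2 + (r - s) * Real.log 2 = r * Real.log 2 by ring]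
  rw [hfact]
  have he1 : Real.exp ((r - s) * Real.log 2) - 1 ≤ 2 * ((r - s) * Real.log 2) := by
    have h := Real.abs_exp_sub_one_le (x := (r - s) * Real.log 2) (by rw [abs_of_nonneg hvu0]; exact hvu1)
    rw [abs_of_nonneg hvu0] at h
    exact (le_abs_self _).trans h
  have he0 : 0 ≤ Real.exp ((r - s) * Real.log 2) - 1 := by
    rw [sub_nonneg]; exact Real.one_le_exp hvu0
  have hexpu : Real.exp (s * Real.log 2) ≤ 2 := by
    calc Real.exp (s * Real.log 2) ≤ Real.exp (1 * Real.log 2) :=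
          Real.exp_le_exp.mpr (mul_le_mul_of_nonneg_right (by linarith) hlog2pos.le)
      _ = 2 := by rw [one_mul, Real.exp_log two_pos]
  have hprod : (r - s) * Real.log 2 ≤ (r - s) * (7 / 10) :=
    mul_le_mul_of_nonneg_left hlog2.le (by linarith)
  calc Real.exp (s * Real.log 2) * (Real.exp ((r - s) * Real.log 2) - 1)
      ≤ 2 * (2 * ((r - s) * Real.log 2)) := mul_le_mul hexpu he1 he0 (by norm_num)
    _ ≤ 3 * (r - s) := by linarith

/-- The sup-norm distance from the challenger `(qα, pα, 2, ρ)` to `θ = (log 2, r log 2, 2, 2^r)`. -/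
theorem challenger_dist (α ξ : ℂ) (ρ r ε δ : ℝ) (p q : ℕ)
    (hqξ : (q : ℂ) * ξ = ((Real.log 2 : ℝ) : ℂ))
    (hpξ : (p : ℂ) * ξ = (((p : ℝ) / q * Real.log 2 : ℝ) : ℂ))
    (hε : ‖ξ - α‖ = ε) (hε0 : 0 ≤ ε) (hpq : (p : ℝ) ≤ q)
    (hδ : r - p / q = δ) (hδ0 : 0 ≤ δ) (hρ : |ρ - (2 : ℝ) ^ r| ≤ 3 * δ) :
    ‖Sum.elim ![(q : ℂ) * α, (p : ℂ) * α] ![(2 : ℂ), (ρ : ℂ)] -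
      Sum.elim ![((Real.log 2 : ℝ) : ℂ), ((r * Real.log 2 : ℝ) : ℂ)]
        (Complex.exp ∘ ![((Real.log 2 : ℝ) : ℂ), ((r * Real.log 2 : ℝ) : ℂ)])‖ ≤ q * ε + 3 * δ := by
  have hlog2 : Real.log 2 ≤ 1 := by have := Real.log_two_lt_d9; linarith
  have hlog2pos : 0 < Real.log 2 := Real.log_pos (by norm_num)
  have hθ3 : Complex.exp ((Real.log 2 : ℝ) : ℂ) = 2 := by
    rw [← Complex.ofReal_exp, Real.exp_log two_pos]; push_cast; rfl
  have hθ4 : Complex.exp ((r * Real.log 2 : ℝ) : ℂ) = (((2 : ℝ) ^ r : ℝ) : ℂ) := by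
    rw [← Complex.ofReal_exp, Real.rpow_def_of_pos two_pos, mul_comm]
  have hq0 : 0 ≤ (q : ℝ) * ε := by positivity
  have hqε : ‖(q : ℂ) * α - ((Real.log 2 : ℝ) : ℂ)‖ = q * ε := by
    rw [← hqξ, ← mul_sub, norm_mul, Complex.norm_natCast, norm_sub_rev, hε]
  have hpε : ‖(p : ℂ) * α - ((r * Real.log 2 : ℝ) : ℂ)‖ ≤ q * ε + 3 * δ := by
    have hsplit : (p : ℂ) * α - ((r * Real.log 2 : ℝ) : ℂ) =
        (p : ℂ) * (α - ξ) + ((((p : ℝ) / q * Real.log 2 - r * Real.log 2 : ℝ)) : ℂ) := by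
      rw [mul_sub, hpξ]; push_cast; ring
    rw [hsplit]
    refine (norm_add_le _ _).trans ?_
    rw [norm_mul, Complex.norm_natCast, norm_sub_rev, hε, Complex.norm_real, Real.norm_eq_abs]
    have h1 : (p : ℝ) * ε ≤ q * ε := mul_le_mul_of_nonneg_right hpq hε0
    have h2 : |(p : ℝ) / q * Real.log 2 - r * Real.log 2| = δ * Real.log 2 := by
      rw [abs_sub_comm, show r * Real.log 2 - (p : ℝ) / q * Real.log 2 = δ * Real.log 2 by
        rw [← hδ]; ring, abs_of_nonneg (by positivity)]
    rw [h2]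
    have h3 : δ * Real.log 2 ≤ δ * 1 := mul_le_mul_of_nonneg_left hlog2 hδ0
    linarith
  have h3 : ‖(2 : ℂ) - Complex.exp ((Real.log 2 : ℝ) : ℂ)‖ ≤ q * ε + 3 * δ := by
    rw [hθ3, sub_self, norm_zero]; positivity
  have h4 : ‖(ρ : ℂ) - Complex.exp ((r * Real.log 2 : ℝ) : ℂ)‖ ≤ q * ε + 3 * δ := by
    rw [hθ4, ← Complex.ofReal_sub, Complex.norm_real, Real.norm_eq_abs]
    linarith
  have hqε' : ‖(q : ℂ) * α - ((Real.log 2 : ℝ) : ℂ)‖ ≤ q * ε + 3 * δ := by rw [hqε]; linarith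
  refine (pi_norm_le_iff_of_nonneg (by positivity)).mpr ?_
  rintro (i | i) <;> fin_cases i
  · simpa using hqε'
  · simpa using hpε
  · simpa using h3
  · simpa using h4

/-- Exponent bookkeeping of the stage lemma. -/
theorem expo_bound (C n q a b lH lMP : ℝ) (hC : 0 ≤ C) (hn : 1 ≤ n) (hq : 1 ≤ q) (hlH0 : 0 ≤ lH)
    (hlH : lH ≤ 3 * (n * q) + lMP) (hlMP : 0 ≤ lMP)
    (hdeg : C * (n * q) ^ (max a 0) ≤ 3 / 1000 * n) :
    C * ((n * q) ^ a * lH + (n * q) ^ b) ≤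
      3 / 1000 * n * lMP + (9 / 1000 * n ^ 2 * q + C * (n * q) ^ (max b 0)) := by
  have hd1 : (1 : ℝ) ≤ n * q := by nlinarith
  have hna : (n * q) ^ a ≤ (n * q) ^ (max a 0) := Real.rpow_le_rpow_of_exponent_le hd1 (le_max_left _ _)
  have hnb : (n * q) ^ b ≤ (n * q) ^ (max b 0) := Real.rpow_le_rpow_of_exponent_le hd1 (le_max_left _ _)
  have hna0 : 0 ≤ (n * q) ^ (max a 0) := by positivity
  have h3 : 0 ≤ 3 * (n * q) + lMP := by positivity
  calc C * ((n * q) ^ a * lH + (n * q) ^ b)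
      ≤ C * ((n * q) ^ (max a 0) * lH + (n * q) ^ (max b 0)) := by gcongr
    _ ≤ C * ((n * q) ^ (max a 0) * (3 * (n * q) + lMP) + (n * q) ^ (max b 0)) := by gcongr
    _ = C * (n * q) ^ (max a 0) * (3 * (n * q) + lMP) + C * (n * q) ^ (max b 0) := by ring
    _ ≤ 3 / 1000 * n * (3 * (n * q) + lMP) + C * (n * q) ^ (max b 0) := by
        have := mul_le_mul_of_nonneg_right hdeg h3
        linarith
    _ = 3 / 1000 * n * lMP + (9 / 1000 * n ^ 2 * q + C * (n * q) ^ (max b 0)) := by ring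

/-- Final real-analysis step of the stage lemma. -/
theorem stage_arith (n q K1 LMP E1 X ε δ dP : ℝ) (hn : 2 ≤ n) (hq : 2 ≤ q) (hK1 : q + 1 ≤ K1)
    (hLMP0 : 0 ≤ LMP) (hLMPM : LMP ≤ K1 / (6 / 1000)) (hdP : 1 ≤ dP)
    (hE1 : E1 = 3 / 1000 * n * LMP + (K1 - q - 1)) (hX : X ≤ E1)
    (hkey : Real.exp (-X) ≤ q * ε + 3 * δ) (hε0 : 0 ≤ ε)
    (hdist : ε ≤ Real.exp (-(6 / 1000 * (n * LMP + dP * (K1 / (6 / 1000))))))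
    (htail : δ < Real.exp (-(n * K1)) / 6) : False := by
  have hK1pos : 0 < K1 := by linarith
  -- (i)
  have h1 : Real.exp (-E1) ≤ q * ε + 3 * δ := (Real.exp_le_exp.mpr (by linarith)).trans hkey
  -- (ii) ε ≤ exp(-0.006 n LMP - K1)
  have h2 : ε ≤ Real.exp (-(6 / 1000 * n * LMP) - K1) := by
    refine hdist.trans (Real.exp_le_exp.mpr ?_)
    have : K1 ≤ dP * (K1 / (6 / 1000)) * (6 / 1000) := by
      rw [mul_assoc, div_mul_cancel₀ K1 (by norm_num : (6 / 1000 : ℝ) ≠ 0)]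
      nlinarith
    nlinarith
  -- (iii) q ε ≤ exp(-E1)/2
  have h3 : q * ε ≤ Real.exp (-E1) / 2 := by
    have he : (2 : ℝ) ≤ Real.exp 1 := by have := Real.exp_one_gt_d9; linarith
    have hq1 : 2 * q ≤ Real.exp (q + 1) := by
      rw [Real.exp_add]
      have := Real.add_one_le_exp q
      nlinarith [Real.exp_pos q]
    have hmain : 2 * q * Real.exp (-(6 / 1000 * n * LMP) - K1) ≤ Real.exp (-E1) := by
      have : Real.exp (q + 1) * Real.exp (-(6 / 1000 * n * LMP) - K1) ≤ Real.exp (-E1) := by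
        rw [← Real.exp_add, Real.exp_le_exp, hE1]
        nlinarith
      have hpos := Real.exp_pos (-(6 / 1000 * n * LMP) - K1)
      nlinarith
    have hqn : (0:ℝ) ≤ q := by linarith
    nlinarith [mul_le_mul_of_nonneg_left h2 hqn]
  -- (iv) 3 δ < exp(-E1)/2
  have h4 : 3 * δ < Real.exp (-E1) / 2 := by
    have hE1le : E1 ≤ n * K1 := by
      rw [hE1]
      have : 3 / 1000 * n * LMP ≤ 1 / 2 * n * K1 := by
        have := mul_le_mul_of_nonneg_left hLMPM (by linarith : (0:ℝ) ≤ 3 / 1000 * n)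
        have h' : 3 / 1000 * n * (K1 / (6 / 1000)) = 1 / 2 * n * K1 := by ring
        linarith
      nlinarith
    have : Real.exp (-(n * K1)) ≤ Real.exp (-E1) := Real.exp_le_exp.mpr (by linarith)
    linarith
  linarith

set_option maxHeartbeats 800000 in
/-- **Stage lemma.** At `θ = (log 2, r log 2, 2, 2^r)` (`s = (log 2, r·log 2)`, `0 ≤ r ≤ 1`), a rational
`p/q ≤ r` (`1 ≤ p ≤ q`, `2 ≤ q`) and a degree budget `n ≥ 50` satisfying the DEGREE CONDITION
`C (nq)^{max a 0} ≤ 0.003 n` and the TAIL CONDITION `r − p/q < exp(−n K₁)/6`,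
`K₁ = q + 1 + 0.009 n² q + C (nq)^{max b 0}`, kill the approximation type `(a, b, C)`: the challenger is
`γ = (q α, p α, 2, 2^{p/q}) ∈ ℚ(α, 2^{1/q})` with `α` Diaz's approximation of `ξ = (log 2)/q` of degree
`≤ n` at scale `M = exp(K₁/0.006)` (`Bugeaud2004_thm_8_11_holds`), budget `d = nq`,
`H = 2^q q^n H(minpoly α)`. [cite: Bugeaud2004, Thm 8.11] -/
theorem stage (a b C r : ℝ) (p q n : ℕ)
    (hq : 2 ≤ q) (hp : 1 ≤ p) (hpq : p ≤ q) (hn : 50 ≤ n)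
    (hr1 : r ≤ 1) (hpr : (p : ℝ) / q ≤ r)
    (hdeg : C * ((n : ℝ) * q) ^ (max a 0) ≤ 3 / 1000 * n)
    (htail : r - p / q < Real.exp (-((n : ℝ) *
      (q + 1 + 9 / 1000 * (n : ℝ) ^ 2 * q + C * ((n : ℝ) * q) ^ (max b 0)))) / 6) :
    ¬ ApproxTypeAt 2 ![((Real.log 2 : ℝ) : ℂ), ((r * Real.log 2 : ℝ) : ℂ)] a b C := by
  rintro ⟨hC, hall⟩
  -- casts and elementary facts
  have hq1 : (1 : ℝ) ≤ q := by exact_mod_cast (le_trans (by norm_num) hq)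
  have hq2 : (2 : ℝ) ≤ q := by exact_mod_cast hq
  have hqpos : (0 : ℝ) < q := by linarith
  have hqC : (q : ℂ) ≠ 0 := by exact_mod_cast hqpos.ne'
  have hn1nat : 1 ≤ n := le_trans (by norm_num) hn
  have hn2 : (2 : ℝ) ≤ n := by exact_mod_cast (le_trans (by norm_num) hn)
  have hn1 : (1 : ℝ) ≤ n := by linarith
  have hnpos : (0 : ℝ) < n := by linarith
  have hpq' : (p : ℝ) ≤ q := by exact_mod_cast hpq
  have hpq1 : (p : ℝ) / q ≤ 1 := by rw [div_le_one hqpos]; exact hpq'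
  have hδ0 : 0 ≤ r - p / q := by linarith
  have hpq0 : (0 : ℝ) ≤ p / q := by positivity
  have hlog2 : Real.log 2 ≤ 1 := by
    have := Real.log_two_lt_d9; linarith
  have hlog2pos : 0 < Real.log 2 := Real.log_pos (by norm_num)
  -- the constants
  set K1 : ℝ := q + 1 + 9 / 1000 * (n : ℝ) ^ 2 * q + C * ((n : ℝ) * q) ^ (max b 0) with hK1
  have hnqb : 0 ≤ C * ((n : ℝ) * q) ^ (max b 0) := by positivity
  have hK1q : (q : ℝ) + 1 ≤ K1 := by
    have : 0 ≤ 9 / 1000 * (n : ℝ) ^ 2 * q := by positivity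
    linarith
  have hK1pos : 0 < K1 := by linarith
  set M : ℝ := Real.exp (K1 / (6 / 1000)) with hMdef
  have hMpos : 0 < M := Real.exp_pos _
  have hlogM : Real.log M = K1 / (6 / 1000) := by rw [hMdef, Real.log_exp]
  have hM1 : (n : ℝ) + 1 ≤ M := by
    have h1 : (n : ℝ) + 1 ≤ K1 / (6 / 1000) := by
      rw [le_div_iff₀ (by norm_num)]
      have : (n : ℝ) ≤ (n : ℝ) ^ 2 * q := by nlinarith
      nlinarith
    calc (n : ℝ) + 1 ≤ K1 / (6 / 1000) := h1
      _ ≤ K1 / (6 / 1000) + 1 := by linarith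
      _ ≤ M := Real.add_one_le_exp _
  -- ξ = (log 2)/q, and Diaz's hypothesis (4 + |ξ|)^100 ≤ M
  set ξ : ℂ := ((Real.log 2 / q : ℝ) : ℂ) with hξ
  have hξnorm : ‖ξ‖ ≤ 1 := by
    rw [hξ, Complex.norm_real, Real.norm_eq_abs, abs_of_nonneg (by positivity)]
    rw [div_le_one hqpos]; linarith
  have hM2 : (4 + ‖ξ‖) ^ 100 ≤ M := by
    have h5 : (4 + ‖ξ‖) ^ 100 ≤ (5 : ℝ) ^ 100 := by
      exact pow_le_pow_left₀ (by positivity) (by linarith) _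
    have he2 : (5 : ℝ) ≤ Real.exp 2 := by
      have := Real.exp_one_gt_d9
      have h : Real.exp 2 = Real.exp 1 * Real.exp 1 := by rw [← Real.exp_add]; norm_num
      nlinarith
    have h200 : (5 : ℝ) ^ 100 ≤ Real.exp 200 := by
      calc (5 : ℝ) ^ 100 ≤ (Real.exp 2) ^ 100 := pow_le_pow_left₀ (by norm_num) he2 100
        _ = Real.exp 200 := by rw [← Real.exp_nat_mul]; norm_num
    have hK200 : (200 : ℝ) ≤ K1 / (6 / 1000) := by
      rw [le_div_iff₀ (by norm_num)]; linarith
    calc (4 + ‖ξ‖) ^ 100 ≤ (5 : ℝ) ^ 100 := h5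
      _ ≤ Real.exp 200 := h200
      _ ≤ M := Real.exp_le_exp.mpr hK200
  -- Diaz
  obtain ⟨α, P, hPirr, hPα, hPdeg, hPM, hdist⟩ := Bugeaud2004_thm_8_11_holds ξ n M hn hM1 hM2
  have hP0 : P ≠ 0 := hPirr.ne_zero
  have hdP : 1 ≤ P.natDegree := by
    rw [Nat.one_le_iff_ne_zero]
    intro h0
    have hc : P = Polynomial.C (P.coeff 0) := eq_C_of_natDegree_eq_zero h0
    rw [hc, aeval_C, algebraMap_int_eq, eq_intCast, Int.cast_eq_zero] at hPα
    exact hP0 (by rw [hc, hPα, map_zero])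
  set MP : ℝ := (P.map (Int.castRingHom ℂ)).mahlerMeasure with hMP
  have hMP1 : 1 ≤ MP := one_le_mahlerMeasure_map P hP0
  have hlogMP : 0 ≤ Real.log MP := Real.log_nonneg hMP1
  have hlogMPM : Real.log MP ≤ K1 / (6 / 1000) := by
    rw [← hlogM]; exact Real.log_le_log (by linarith) hPM
  have hαint : IsIntegral ℚ α := by
    refine (show IsAlgebraic ℚ α from ⟨P.map (Int.castRingHom ℚ), ?_, ?_⟩).isIntegral
    · exact (Polynomial.map_ne_zero_iff (Int.castRingHom ℚ).injective_int).mpr hP0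
    · rw [← algebraMap_int_eq, aeval_map_algebraMap]; exact hPα
  -- ρ = 2^{p/q}
  set ρ : ℝ := (2 : ℝ) ^ ((p : ℝ) / q) with hρ
  have hρpow : ρ ^ q = (2 : ℝ) ^ p := by
    rw [hρ, ← Real.rpow_natCast, ← Real.rpow_mul (by norm_num), div_mul_cancel₀ _ hqpos.ne',
      Real.rpow_natCast]
  set Q : ℤ[X] := X ^ q - Polynomial.C ((2 : ℤ) ^ p) with hQ
  have hq0 : 0 < q := by omega
  have hQ0 : Q ≠ 0 := X_pow_sub_C_ne_zero hq0 _
  have hQdeg : Q.natDegree = q := natDegree_X_pow_sub_C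
  have hQρ : aeval (ρ : ℂ) Q = 0 := by
    rw [hQ, map_sub, map_pow, aeval_X, aeval_C, algebraMap_int_eq, eq_intCast]
    push_cast
    rw [← Complex.ofReal_pow, hρpow]; push_cast; ring
  have hρint : IsIntegral ℚ (ρ : ℂ) := by
    refine (show IsAlgebraic ℚ (ρ : ℂ) from ⟨Q.map (Int.castRingHom ℚ), ?_, ?_⟩).isIntegral
    · exact (Polynomial.map_ne_zero_iff (Int.castRingHom ℚ).injective_int).mpr hQ0
    · rw [← algebraMap_int_eq, aeval_map_algebraMap]; exact hQρ
  -- the challenger and its budget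
  set H : ℕ := 2 ^ q * q ^ n * natHeight P with hHdef
  have hHP1 : 1 ≤ natHeight P := one_le_natHeight P hP0
  have hH1 : 1 ≤ H := by
    rw [hHdef]
    exact Nat.one_le_iff_ne_zero.mpr (Nat.mul_ne_zero (Nat.mul_ne_zero (by positivity) (by positivity))
      (by omega))
  set d : ℕ := n * q with hddef
  set γ : Fin 2 ⊕ Fin 2 → ℂ := Sum.elim ![(q : ℂ) * α, (p : ℂ) * α] ![(2 : ℂ), (ρ : ℂ)] with hγ
  -- field degree ≤ n q
  have hfr : Module.finrank ℚ ↥(IntermediateField.adjoin ℚ (Set.range γ)) ≤ d := by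
    have hle : IntermediateField.adjoin ℚ (Set.range γ) ≤
        IntermediateField.adjoin ℚ {α} ⊔ IntermediateField.adjoin ℚ {(ρ : ℂ)} := by
      rw [IntermediateField.adjoin_le_iff]
      rintro _ ⟨i, rfl⟩
      have hαmem : α ∈ IntermediateField.adjoin ℚ {α} ⊔ IntermediateField.adjoin ℚ {(ρ : ℂ)} :=
        (le_sup_left : IntermediateField.adjoin ℚ {α} ≤ _) (IntermediateField.mem_adjoin_simple_self ℚ α)
      have hρmem : (ρ : ℂ) ∈ IntermediateField.adjoin ℚ {α} ⊔ IntermediateField.adjoin ℚ {(ρ : ℂ)} :=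
        (le_sup_right : IntermediateField.adjoin ℚ {(ρ : ℂ)} ≤ _)
          (IntermediateField.mem_adjoin_simple_self ℚ (ρ : ℂ))
      rcases i with i | i <;> fin_cases i
      · show (q : ℂ) * α ∈ _
        exact mul_mem (natCast_mem _ q) hαmem
      · show (p : ℂ) * α ∈ _
        exact mul_mem (natCast_mem _ p) hαmem
      · show (2 : ℂ) ∈ _
        exact ofNat_mem _ 2
      · show (ρ : ℂ) ∈ _
        exact hρmem
    haveI : FiniteDimensional ℚ (IntermediateField.adjoin ℚ {α}) :=
      IntermediateField.adjoin.finiteDimensional hαint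
    haveI : FiniteDimensional ℚ (IntermediateField.adjoin ℚ {(ρ : ℂ)}) :=
      IntermediateField.adjoin.finiteDimensional hρint
    have hfa : Module.finrank ℚ (IntermediateField.adjoin ℚ {α}) ≤ n := by
      rw [IntermediateField.adjoin.finrank hαint]
      refine le_trans ?_ hPdeg
      have h := minpoly.degree_le_of_ne_zero ℚ α
        ((Polynomial.map_ne_zero_iff (Int.castRingHom ℚ).injective_int).mpr hP0)
        (by rw [← algebraMap_int_eq, aeval_map_algebraMap]; exact hPα)
      have h' := natDegree_le_natDegree h
      rwa [natDegree_map_eq_of_injective (Int.castRingHom ℚ).injective_int] at h'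
    have hfρ : Module.finrank ℚ (IntermediateField.adjoin ℚ {(ρ : ℂ)}) ≤ q := by
      rw [IntermediateField.adjoin.finrank hρint]
      refine le_trans ?_ hQdeg.le
      have h := minpoly.degree_le_of_ne_zero ℚ (ρ : ℂ)
        ((Polynomial.map_ne_zero_iff (Int.castRingHom ℚ).injective_int).mpr hQ0)
        (by rw [← algebraMap_int_eq, aeval_map_algebraMap]; exact hQρ)
      have h' := natDegree_le_natDegree h
      rwa [natDegree_map_eq_of_injective (Int.castRingHom ℚ).injective_int] at h'
    calc Module.finrank ℚ ↥(IntermediateField.adjoin ℚ (Set.range γ))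
        ≤ Module.finrank ℚ ↥(IntermediateField.adjoin ℚ {α} ⊔ IntermediateField.adjoin ℚ {(ρ : ℂ)}) :=
          IntermediateField.finrank_le_of_le_right hle
      _ ≤ Module.finrank ℚ (IntermediateField.adjoin ℚ {α}) *
            Module.finrank ℚ (IntermediateField.adjoin ℚ {(ρ : ℂ)}) :=
          IntermediateField.finrank_sup_le _ _
      _ ≤ n * q := Nat.mul_le_mul hfa hfρ
  -- the integer polynomials of the four coordinates
  have hHq : q ^ n * natHeight P ≤ H := by
    rw [hHdef, mul_assoc]; exact Nat.le_mul_of_pos_left _ (by positivity)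
  have hH2q : 2 ^ q ≤ H := by
    rw [hHdef, mul_assoc]; exact Nat.le_mul_of_pos_right _ (Nat.mul_pos (by positivity) (by omega))
  have hdn : n ≤ d := by rw [hddef]; exact Nat.le_mul_of_pos_right _ hq0
  have hdq : q ≤ d := by rw [hddef]; exact Nat.le_mul_of_pos_left _ (by omega)
  have hscale : ∀ m : ℕ, 1 ≤ m → m ≤ q → ∃ R : ℤ[X], R ≠ 0 ∧ R.natDegree ≤ d ∧
      (∀ k, |R.coeff k| ≤ (H : ℤ)) ∧ aeval ((m : ℂ) * α) R = 0 := by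
    intro m hm1 hmq
    refine ⟨scaleRoots P (m : ℤ), scaleRoots_ne_zero hP0 _, ?_, ?_, ?_⟩
    · rw [natDegree_scaleRoots]; exact hPdeg.trans hdn
    · intro k
      rw [coeff_scaleRoots, abs_mul]
      have h1 : |P.coeff k| ≤ (natHeight P : ℤ) := abs_coeff_le_natHeight P k
      have h2 : |((m : ℤ)) ^ (P.natDegree - k)| ≤ (q : ℤ) ^ n := by
        rw [abs_pow, Nat.abs_cast]
        calc (m : ℤ) ^ (P.natDegree - k) ≤ (q : ℤ) ^ (P.natDegree - k) :=
              pow_le_pow_left₀ (by positivity) (by exact_mod_cast hmq) _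
          _ ≤ (q : ℤ) ^ n := pow_le_pow_right₀ (by exact_mod_cast hq1) (by omega)
      calc |P.coeff k| * |(m : ℤ) ^ (P.natDegree - k)| ≤ (natHeight P : ℤ) * (q : ℤ) ^ n :=
            mul_le_mul h1 h2 (abs_nonneg _) (by positivity)
        _ = ((q ^ n * natHeight P : ℕ) : ℤ) := by push_cast; ring
        _ ≤ H := by exact_mod_cast hHq
    · have := scaleRoots_aeval_eq_zero (A := ℂ) (r := (m : ℤ)) hPα
      simpa using this
  have hcl : ∀ i, ∃ R : Polynomial ℤ, R ≠ 0 ∧ R.natDegree ≤ d ∧ (∀ k, |R.coeff k| ≤ (H : ℤ)) ∧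
      Polynomial.aeval (γ i) R = 0 := by
    rintro (i | i) <;> fin_cases i
    · exact hscale q (by omega) le_rfl
    · exact hscale p hp hpq
    · refine ⟨X - Polynomial.C 2, X_sub_C_ne_zero 2, ?_, ?_, ?_⟩
      · rw [natDegree_X_sub_C]; exact hn1nat.trans hdn
      · intro k
        have hH2 : (2 : ℤ) ≤ H := by
          have : 2 ≤ 2 ^ q := by
            calc 2 = 2 ^ 1 := by norm_num
              _ ≤ 2 ^ q := Nat.pow_le_pow_right (by norm_num) (by omega)
          exact_mod_cast this.trans hH2q
        rw [coeff_sub, coeff_X, coeff_C]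
        split_ifs <;> simp <;> omega
      · have h2 : aeval (2 : ℂ) (X - Polynomial.C (2 : ℤ)) = 0 := by
          rw [map_sub, aeval_X, aeval_C, algebraMap_int_eq, eq_intCast]; push_cast; ring
        exact h2
    · refine ⟨Q, hQ0, hQdeg.le.trans hdq, ?_, ?_⟩
      · intro k
        have hH2p : (2 : ℤ) ^ p ≤ H := by
          have : 2 ^ p ≤ 2 ^ q := Nat.pow_le_pow_right (by norm_num) hpq
          exact_mod_cast this.trans hH2q
        have hH1' : (1 : ℤ) ≤ H := by exact_mod_cast hH1
        rw [hQ, coeff_sub, coeff_X_pow, coeff_C]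
        split_ifs <;> simp <;> omega
      · exact hQρ
  have key := hall d H γ hfr hcl
  -- (1) distance
  have hqξ : (q : ℂ) * ξ = ((Real.log 2 : ℝ) : ℂ) := by
    rw [hξ]; push_cast; field_simp
  have hpξ : (p : ℂ) * ξ = (((p : ℝ) / q * Real.log 2 : ℝ) : ℂ) := by
    rw [hξ]; push_cast; field_simp
  have hρr : |ρ - (2 : ℝ) ^ r| ≤ 3 * (r - p / q) := by
    rw [abs_sub_comm, abs_of_nonneg (by
      rw [sub_nonneg, hρ]
      exact Real.rpow_le_rpow_of_exponent_le (by norm_num) hpr)]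
    rw [hρ]
    exact two_rpow_sub_le hpq0 hpr hr1
  have hbound := challenger_dist α ξ ρ r ‖ξ - α‖ (r - p / q) p q hqξ hpξ rfl (norm_nonneg _) hpq'
    rfl hδ0 hρr
  -- (2) exponents
  have hdcast : ((d : ℕ) : ℝ) = (n : ℝ) * q := by rw [hddef]; push_cast; ring
  have hHcast : ((H : ℕ) : ℝ) = (2 : ℝ) ^ q * (q : ℝ) ^ n * (natHeight P : ℝ) := by
    rw [hHdef]; push_cast; ring
  have hlogHP : Real.log (natHeight P) ≤ n + Real.log MP := by
    have h1 : (natHeight P : ℝ) ≤ 2 ^ P.natDegree * MP := natHeight_le P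
    have h2 : (2 : ℝ) ^ P.natDegree ≤ 2 ^ n := pow_le_pow_right₀ (by norm_num) hPdeg
    have h3 : (natHeight P : ℝ) ≤ 2 ^ n * MP := h1.trans (by gcongr)
    have h4 : (n : ℝ) * Real.log 2 ≤ n := by
      have := mul_le_mul_of_nonneg_left hlog2 hnpos.le; rwa [mul_one] at this
    calc Real.log (natHeight P) ≤ Real.log (2 ^ n * MP) := Real.log_le_log (by positivity) h3
      _ = n * Real.log 2 + Real.log MP := by
        rw [Real.log_mul (by positivity) (by positivity), Real.log_pow]
      _ ≤ n + Real.log MP := by linarith only [h4]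
  have hlogq : Real.log q ≤ q := by
    have := Real.log_le_sub_one_of_pos hqpos; linarith
  have hlogH : Real.log H ≤ 3 * ((n : ℝ) * q) + Real.log MP := by
    rw [hHcast, Real.log_mul (by positivity) (by positivity), Real.log_mul (by positivity) (by positivity),
      Real.log_pow, Real.log_pow]
    have h1 : (q : ℝ) * Real.log 2 ≤ (n : ℝ) * q := by
      calc (q : ℝ) * Real.log 2 ≤ q * 1 := mul_le_mul_of_nonneg_left hlog2 hqpos.le
        _ ≤ n * q := by rw [mul_one]; exact le_mul_of_one_le_left hqpos.le hn1
    have h2 : (n : ℝ) * Real.log q ≤ (n : ℝ) * q := mul_le_mul_of_nonneg_left hlogq hnpos.le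
    have h3 : (n : ℝ) ≤ (n : ℝ) * q := le_mul_of_one_le_right hnpos.le hq1
    linarith only [h1, h2, h3, hlogHP]
  have hlogH0 : 0 ≤ Real.log H := Real.log_nonneg (by exact_mod_cast hH1)
  have hexpo := expo_bound C n q a b (Real.log H) (Real.log MP) hC.le hn1 hq1 hlogH0 hlogH hlogMP hdeg
  rw [hdcast] at key
  have hK1split : K1 - q - 1 = 9 / 1000 * (n : ℝ) ^ 2 * q + C * ((n : ℝ) * q) ^ (max b 0) := by
    rw [hK1]; ring
  have hX : C * (((n : ℝ) * q) ^ a * Real.log H + ((n : ℝ) * q) ^ b) ≤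
      3 / 1000 * n * Real.log MP + (K1 - q - 1) := by rw [hK1split]; exact hexpo
  rw [hlogM] at hdist
  exact stage_arith n q K1 (Real.log MP) (3 / 1000 * n * Real.log MP + (K1 - q - 1))
    (C * (((n : ℝ) * q) ^ a * Real.log H + ((n : ℝ) * q) ^ b)) ‖ξ - α‖ (r - p / q) P.natDegree
    hn2 hq2 hK1q hlogMP hlogMPM (by exact_mod_cast hdP) rfl hX (key.trans hbound)
    (norm_nonneg _) hdist htail


/-! ## Assembly: the Khovanskii system is load-bearing -/

open Tower in
/-- `s = (log 2, r·log 2)` is ℚ-linearly independent (`r` irrational, `log 2 ≠ 0`). -/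
theorem linearIndependent_log2_pair :
    LinearIndependent ℚ ![((Real.log 2 : ℝ) : ℂ), ((r * Real.log 2 : ℝ) : ℂ)] := by
  have hlog2 : Real.log 2 ≠ 0 := (Real.log_pos (by norm_num)).ne'
  rw [LinearIndependent.pair_iff]
  intro c d hcd
  have h1 : ((c : ℝ) + (d : ℝ) * r) * Real.log 2 = 0 := by
    have : (((((c : ℝ) + (d : ℝ) * r) * Real.log 2 : ℝ)) : ℂ) = 0 := by
      push_cast
      rw [Rat.smul_def, Rat.smul_def] at hcd
      push_cast at hcd
      linear_combination hcd
    exact_mod_cast this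
  have h2 : (c : ℝ) + (d : ℝ) * r = 0 := by
    rcases mul_eq_zero.mp h1 with h | h
    · exact h
    · exact absurd h hlog2
  by_cases hd : d = 0
  · subst hd
    simp at h2
    exact ⟨by exact_mod_cast h2, rfl⟩
  · exfalso
    have hd' : (d : ℝ) ≠ 0 := by exact_mod_cast hd
    have : r = ((-c / d : ℚ) : ℝ) := by
      push_cast
      field_simp
      linarith
    exact irrational_r ⟨-c / d, this.symm⟩

open Tower in
/-- Degree condition of the stage `k`: with `q = 10^{t_k}`, `n = q^k`, `k ≥ (1+a')/(1−a')`,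
`k ≥ 334 C`: `C (nq)^{a'} ≤ 0.003 n`. -/
theorem stage_choice_deg (a' C : ℝ) (k q n : ℕ) (hq : q = 10 ^ t k) (hn : n = q ^ k) (hC : 0 ≤ C)
    (ha'1 : a' < 1) (hka : (1 + a') / (1 - a') ≤ k) (hkC : 334 * C ≤ k) (hk1 : 1 ≤ k) :
    C * ((n : ℝ) * q) ^ a' ≤ 3 / 1000 * n := by
  have h1a' : 0 < 1 - a' := by linarith
  have hq10 : 10 ^ (k + 1) ≤ q := by rw [hq]; exact Nat.pow_le_pow_right (by norm_num) (succ_le_t k)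
  have hkq : k + 1 < q := lt_of_lt_of_le (Nat.lt_pow_self (by norm_num)) hq10
  have hqR : (k : ℝ) + 1 < q := by exact_mod_cast hkq
  have hq1R : (1 : ℝ) ≤ q := by linarith
  have hqpos : (0 : ℝ) < q := by linarith
  have hnR : (n : ℝ) = (q : ℝ) ^ k := by rw [hn]; push_cast; ring
  have hexp : ((k : ℝ) + 1) * a' ≤ (k : ℝ) - 1 := by
    have := (div_le_iff₀ h1a').mp hka
    nlinarith
  have h1 : ((n : ℝ) * q) ^ a' ≤ (q : ℝ) ^ (k - 1) := by
    rw [hnR, ← pow_succ, ← Real.rpow_natCast, ← Real.rpow_mul hqpos.le]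
    have h := Real.rpow_le_rpow_of_exponent_le hq1R hexp
    have hcast : ((k - 1 : ℕ) : ℝ) = (k : ℝ) - 1 := by push_cast [Nat.cast_sub hk1]; ring
    rw [← Real.rpow_natCast _ (k - 1), hcast]
    push_cast at h ⊢
    exact h
  have hCq : C ≤ 3 / 1000 * q := by linarith
  calc C * ((n : ℝ) * q) ^ a' ≤ C * (q : ℝ) ^ (k - 1) := mul_le_mul_of_nonneg_left h1 hC
    _ ≤ 3 / 1000 * q * (q : ℝ) ^ (k - 1) := mul_le_mul_of_nonneg_right hCq (by positivity)
    _ = 3 / 1000 * n := by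
        rw [hnR, mul_assoc, ← pow_succ', Nat.sub_add_cancel hk1]

/-- First half of the tail bound: `n K₁ ≤ (3 + C) q^E`, `E = (k+1)B + 3k + 3`, `B = ⌈b'⌉`. -/
theorem stage_choice_T1 (C b' : ℝ) (k q n B E : ℕ) (hq1 : 1 ≤ q) (hn : n = q ^ k) (hC : 0 ≤ C)
    (hbB : b' ≤ B) (hE : E = (k + 1) * B + (3 * k + 3)) :
    (n : ℝ) * (q + 1 + 9 / 1000 * (n : ℝ) ^ 2 * q + C * ((n : ℝ) * q) ^ b') ≤ (3 + C) * (q : ℝ) ^ E := by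
  have hq1R : (1 : ℝ) ≤ q := by exact_mod_cast hq1
  have hnR : (n : ℝ) = (q : ℝ) ^ k := by rw [hn]; push_cast; ring
  have hn1 : (1 : ℝ) ≤ n := by rw [hnR]; exact one_le_pow₀ hq1R
  have hpowb : ((n : ℝ) * q) ^ b' ≤ (q : ℝ) ^ ((k + 1) * B) := by
    have hbase : (1 : ℝ) ≤ (n : ℝ) * q := by nlinarith
    calc ((n : ℝ) * q) ^ b' ≤ ((n : ℝ) * q) ^ (B : ℝ) := Real.rpow_le_rpow_of_exponent_le hbase hbB
      _ = (q : ℝ) ^ ((k + 1) * B) := by rw [Real.rpow_natCast, hnR, ← pow_succ, ← pow_mul]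
  have hqE : ∀ e : ℕ, e ≤ E → (q : ℝ) ^ e ≤ (q : ℝ) ^ E := fun e he => pow_le_pow_right₀ hq1R he
  have e1 : (q : ℝ) ^ k * q ≤ (q : ℝ) ^ E := by rw [← pow_succ]; exact hqE (k + 1) (by rw [hE]; omega)
  have e2 : (q : ℝ) ^ k * 1 ≤ (q : ℝ) ^ E := by rw [mul_one]; exact hqE k (by rw [hE]; omega)
  have e3 : (q : ℝ) ^ k * (9 / 1000 * ((q : ℝ) ^ k) ^ 2 * q) ≤ (q : ℝ) ^ E := by
    have h := hqE (3 * k + 1) (by rw [hE]; omega)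
    have h0 : 0 ≤ (q : ℝ) ^ (3 * k + 1) := by positivity
    calc (q : ℝ) ^ k * (9 / 1000 * ((q : ℝ) ^ k) ^ 2 * q) = 9 / 1000 * (q : ℝ) ^ (3 * k + 1) := by ring
      _ ≤ (q : ℝ) ^ E := by linarith
  have e4 : (q : ℝ) ^ k * (C * ((n : ℝ) * q) ^ b') ≤ C * (q : ℝ) ^ E := by
    have h := hqE (k + (k + 1) * B) (by rw [hE]; omega)
    calc (q : ℝ) ^ k * (C * ((n : ℝ) * q) ^ b') ≤ (q : ℝ) ^ k * (C * (q : ℝ) ^ ((k + 1) * B)) :=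
          mul_le_mul_of_nonneg_left (mul_le_mul_of_nonneg_left hpowb hC) (by positivity)
      _ = C * (q : ℝ) ^ (k + (k + 1) * B) := by rw [pow_add]; ring
      _ ≤ C * (q : ℝ) ^ E := mul_le_mul_of_nonneg_left h hC
  calc (n : ℝ) * (q + 1 + 9 / 1000 * (n : ℝ) ^ 2 * q + C * ((n : ℝ) * q) ^ b')
      = (q : ℝ) ^ k * q + (q : ℝ) ^ k * 1 + (q : ℝ) ^ k * (9 / 1000 * ((q : ℝ) ^ k) ^ 2 * q)
        + (q : ℝ) ^ k * (C * ((n : ℝ) * q) ^ b') := by rw [hnR]; ring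
    _ ≤ (q : ℝ) ^ E + (q : ℝ) ^ E + (q : ℝ) ^ E + C * (q : ℝ) ^ E := by linarith
    _ = (3 + C) * (q : ℝ) ^ E := by ring

open Tower in
/-- Second half of the tail bound: `(3 + C) q^E ≤ t_{k+1}` for `k + 1 ≥ B + 4`, `k ≥ C + 1`. -/
theorem stage_choice_T2 (C : ℝ) (k B E : ℕ) (hE : E = (k + 1) * B + (3 * k + 3))
    (hkB : B + 4 ≤ k + 1) (hkC1 : C + 1 ≤ k) :
    (3 + C) * (((10 ^ t k : ℕ) : ℝ)) ^ E ≤ t (k + 1) := by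
  have hqE : (((10 ^ t k : ℕ) : ℝ)) ^ E = (10 : ℝ) ^ (t k * E) := by push_cast; rw [← pow_mul]
  have htk : (t (k + 1) : ℝ) = (10 : ℝ) ^ ((k + 1) ^ 2 * t k) := by rw [t_succ]; push_cast; ring
  have hexpN : t k * E + (k + 1) ≤ (k + 1) ^ 2 * t k := by
    have h1 : (B + 4) * ((k + 1) * t k) ≤ (k + 1) * ((k + 1) * t k) := Nat.mul_le_mul_right _ hkB
    have h2 : (B + 4) * ((k + 1) * t k) = t k * E + (k + 1) * t k := by rw [hE]; ring
    have h3 : (k + 1) * 1 ≤ (k + 1) * t k := Nat.mul_le_mul_left _ (one_le_t k)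
    have h4 : (k + 1) * ((k + 1) * t k) = (k + 1) ^ 2 * t k := by ring
    omega
  have h10 : (k : ℝ) + 2 ≤ (10 : ℝ) ^ (k + 1) := by
    have h := (Nat.lt_pow_self (by norm_num : 1 < 10) : k + 1 < 10 ^ (k + 1))
    exact_mod_cast (show k + 2 ≤ 10 ^ (k + 1) by omega)
  rw [hqE, htk]
  have hpos : (0 : ℝ) ≤ (10 : ℝ) ^ (t k * E) := by positivity
  calc (3 + C) * (10 : ℝ) ^ (t k * E) ≤ ((k : ℝ) + 2) * (10 : ℝ) ^ (t k * E) :=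
        mul_le_mul_of_nonneg_right (by linarith) hpos
    _ ≤ (10 : ℝ) ^ (k + 1) * (10 : ℝ) ^ (t k * E) := mul_le_mul_of_nonneg_right h10 hpos
    _ = (10 : ℝ) ^ (t k * E + (k + 1)) := by rw [pow_add]; ring
    _ ≤ (10 : ℝ) ^ ((k + 1) ^ 2 * t k) := pow_le_pow_right₀ (by norm_num) hexpN

/-- The tail comparison: `2·10^{−T} < e^{−x}/6` once `x ≤ T` and `T ≥ 10`. -/
theorem stage_choice_tail (x : ℝ) (T : ℕ) (hT : 10 ≤ T) (hx : x ≤ T) :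
    2 * (1 / 10 : ℝ) ^ T < Real.exp (-x) / 6 := by
  have hTR : (10 : ℝ) ≤ T := by exact_mod_cast hT
  have he2 : Real.exp 2 ≤ 10 := by
    have := Real.exp_one_lt_d9
    have h : Real.exp 2 = Real.exp 1 * Real.exp 1 := by rw [← Real.exp_add]; norm_num
    nlinarith [Real.exp_pos 1]
  have hpow : (1 / 10 : ℝ) ^ T ≤ Real.exp (-2 * T) := by
    rw [show (-2 : ℝ) * T = (T : ℕ) * (-2) by ring, Real.exp_nat_mul]
    apply pow_le_pow_left₀ (by norm_num)
    rw [Real.exp_neg, one_div, inv_le_inv₀ (by norm_num) (Real.exp_pos 2)]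
    exact he2
  have he4 : (16 : ℝ) ≤ Real.exp T := by
    have h2 : (2 : ℝ) ≤ Real.exp 1 := by have := Real.add_one_le_exp (1 : ℝ); norm_num at this; linarith
    calc (16 : ℝ) = 2 ^ 4 := by norm_num
      _ ≤ (Real.exp 1) ^ 4 := pow_le_pow_left₀ (by norm_num) h2 4
      _ = Real.exp 4 := by rw [← Real.exp_nat_mul]; norm_num
      _ ≤ Real.exp T := Real.exp_le_exp.mpr (by linarith)
  have hkey : 2 * Real.exp (-2 * T) < Real.exp (-(T : ℝ)) / 6 := by
    have hsplit : Real.exp (-2 * T) = Real.exp (-(T : ℝ)) * Real.exp (-(T : ℝ)) := by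
      rw [← Real.exp_add]; ring_nf
    rw [hsplit]
    have hinv : Real.exp (-(T : ℝ)) ≤ 1 / 16 := by
      rw [Real.exp_neg, one_div, inv_le_inv₀ (Real.exp_pos _) (by norm_num)]; exact he4
    have hpos := Real.exp_pos (-(T : ℝ))
    nlinarith
  have hmono : Real.exp (-(T : ℝ)) ≤ Real.exp (-x) := Real.exp_le_exp.mpr (by linarith)
  calc 2 * (1 / 10 : ℝ) ^ T ≤ 2 * Real.exp (-2 * T) := by linarith
    _ < Real.exp (-(T : ℝ)) / 6 := hkey
    _ ≤ Real.exp (-x) / 6 := by linarith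

open Tower in
/-- No approximation type with `a < 1` at `θ = (log 2, r log 2, 2, 2^r)`: choose the stage `k` of the
tower large in terms of `(a, b, C)` and apply `stage`. -/
theorem not_approxTypeAt_log2_pair (a b C : ℝ) (ha : a < 1) :
    ¬ ApproxTypeAt 2 ![((Real.log 2 : ℝ) : ℂ), ((r * Real.log 2 : ℝ) : ℂ)] a b C := by
  intro hAT
  have hC : 0 < C := hAT.1
  set a' : ℝ := max a 0 with ha'
  set b' : ℝ := max b 0 with hb'
  have ha'0 : 0 ≤ a' := le_max_right _ _
  have ha'1 : a' < 1 := max_lt ha one_pos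
  have hb'0 : 0 ≤ b' := le_max_right _ _
  have h1a' : 0 < 1 - a' := by linarith
  -- the stage
  set k : ℕ := ⌈334 * C + (1 + a') / (1 - a') + b' + 6⌉₊ with hkdef
  have hkR : 334 * C + (1 + a') / (1 - a') + b' + 6 ≤ k := Nat.le_ceil _
  have hfrac0 : 0 ≤ (1 + a') / (1 - a') := by positivity
  have hkC : 334 * C ≤ k := by linarith
  have hkC1 : C + 1 ≤ k := by linarith
  have hka : (1 + a') / (1 - a') ≤ k := by linarith
  have hk1 : 1 ≤ k := by
    have : (1 : ℝ) ≤ k := by linarith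
    exact_mod_cast this
  set B : ℕ := ⌈b'⌉₊ with hBdef
  have hbB : b' ≤ B := Nat.le_ceil _
  have hBb : (B : ℝ) < b' + 1 := Nat.ceil_lt_add_one hb'0
  have hkB : B + 4 ≤ k + 1 := by
    have : (B : ℝ) + 4 ≤ (k : ℝ) + 1 := by linarith
    exact_mod_cast this
  -- q, p, n
  set q : ℕ := 10 ^ t k with hqdef
  set p : ℕ := pnum k with hpdef
  set n : ℕ := q ^ k with hndef
  have hq100 : 10 ^ 2 ≤ q := Nat.pow_le_pow_right (by norm_num) ((show 2 ≤ k + 1 by omega).trans (succ_le_t k))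
  have hq2 : 2 ≤ q := le_trans (by norm_num) hq100
  have hq1 : 1 ≤ q := le_trans (by norm_num) hq2
  have hqpos : (0 : ℝ) < q := by exact_mod_cast (lt_of_lt_of_le (by norm_num) hq1)
  have hp1 : 1 ≤ p := one_le_pnum k
  have hpq : p ≤ q := (pnum_lt k).le
  have hqn : q ≤ n := by
    rw [hndef]
    calc q = q ^ 1 := (pow_one q).symm
      _ ≤ q ^ k := Nat.pow_le_pow_right hq1 hk1
  have hn50 : 50 ≤ n := le_trans (le_trans (by norm_num) hq100) hqn
  -- r, p/q
  have hpq_eq : (p : ℝ) / q = rpart k := by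
    rw [rpart_eq, hpdef, hqdef]; push_cast; ring
  have hr1 : r ≤ 1 := r_le.trans (by norm_num)
  have hpr : (p : ℝ) / q ≤ r := by rw [hpq_eq]; exact (rpart_lt_r k).le
  -- degree condition
  have hdeg : C * ((n : ℝ) * q) ^ a' ≤ 3 / 1000 * n :=
    stage_choice_deg a' C k q n rfl rfl hC.le ha'1 hka hkC hk1
  -- tail condition
  have hT1 := stage_choice_T1 C b' k q n B ((k + 1) * B + (3 * k + 3)) hq1 rfl hC.le hbB rfl
  have hT2 := stage_choice_T2 C k B ((k + 1) * B + (3 * k + 3)) rfl hkB hkC1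
  have hT10 : 10 ≤ t (k + 1) := by
    rw [t_succ]
    calc 10 = 10 ^ 1 := by norm_num
      _ ≤ 10 ^ ((k + 1) ^ 2 * t k) := Nat.pow_le_pow_right (by norm_num)
          (Nat.one_le_iff_ne_zero.mpr (Nat.mul_ne_zero (by positivity) (by have := one_le_t k; omega)))
  have htail : r - p / q < Real.exp (-((n : ℝ) *
      (q + 1 + 9 / 1000 * (n : ℝ) ^ 2 * q + C * ((n : ℝ) * q) ^ (max b 0)))) / 6 := by
    have htl : r - p / q ≤ 2 * (1 / 10 : ℝ) ^ t (k + 1) := by rw [hpq_eq]; exact tail_le k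
    have hqcast : (q : ℝ) = (((10 ^ t k : ℕ) : ℝ)) := by rw [hqdef]
    rw [hqcast] at hT1
    exact lt_of_le_of_lt htl (stage_choice_tail _ (t (k + 1)) hT10 ((hqcast ▸ hT1).trans hT2 |>.trans (le_of_eq rfl)) |>.trans_le (le_of_eq (by rw [hqcast])))
  exact stage a b C r p q n hq2 hp1 hpq hn50 hr1 hpr hdeg htail hAT

/-- **The Khovanskii system is load-bearing:** with `IsFreeKhovanskii` dropped the crux fails at the
ℚ-linearly independent Gel'fond–Schneider-type point `s = (log 2, r·log 2)`, `r = ∑ 10^{−t_j}` the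
ultra-Liouville number of the tower `t₀ = 1, t_{j+1} = 10^{(j+1)² t_j}`:
`θ = (log 2, r log 2, 2, 2^r)` is the hyper-fast limit of the DEGENERATE (lin. dependent) points
`θ_k = (log 2, r_k log 2, 2, 2^{r_k})`, `r_k = p_k/q_k`, each generated by the single number
`ξ_k = (log 2)/q_k`, so Diaz's challengers `(q_k α, p_k α, 2, 2^{p_k/q_k})` beat every `a < 1`. -/
theorem khovanskiiApproxType_false_without_khovanskii : ¬ KhovanskiiApproxTypeWithoutKhovanskii := by
  intro h
  obtain ⟨a, b, C, ha, hAT⟩ := h 2 _ le_rfl linearIndependent_log2_pair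
  have ha1 : a < 1 := by norm_num at ha; linarith
  exact not_approxTypeAt_log2_pair a b C ha1 hAT


/-! ## (d′) Line vocabulary: slot floors need `A ≥ 1` (Dirichlet) -/

open Literature.NumberTheory.DiophantineApproximation (exists_int_poly_small_value) in
set_option maxHeartbeats 400000 in
/-- **No slot floor with degree exponent `A < 1` exists, at any `ξ ∈ ℂ`** (Dirichlet / Bugeaud
Lemma 8.1). [cite: Bugeaud2004, Lemma 8.1] -/
theorem slotFloor_false_of_lt_one (ξ : ℂ) (A K C : ℝ) (hA : A < 1) : ¬ SlotFloor ξ A K C := by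
  rintro ⟨hC, hfl⟩
  set A' : ℝ := max A 0 with hA'
  set K' : ℝ := max K 0 with hK'
  have hA'1 : A' < 1 := max_lt hA one_pos
  have hA'0 : 0 ≤ A' := le_max_right _ _
  have hK'0 : 0 ≤ K' := le_max_right _ _
  obtain ⟨n, hn50, hn⟩ := exists_deg A' C hA'1 hC
  have hn1 : (1 : ℝ) ≤ n := by exact_mod_cast (le_trans (by norm_num) hn50)
  have hnpos : (0 : ℝ) < n := by linarith
  -- the height scale
  set H : ℝ := max ((4 + ‖ξ‖) ^ 50) (Real.exp (C * (n : ℝ) ^ K' + 1)) with hHdef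
  have hHξ : (4 + ‖ξ‖) ^ 50 ≤ H := le_max_left _ _
  have hH4 : (4 : ℝ) ^ 50 ≤ H :=
    le_trans (pow_le_pow_left₀ (by norm_num) (by linarith [norm_nonneg ξ]) 50) hHξ
  have hH1 : (1 : ℝ) ≤ H := le_trans (by norm_num) hH4
  have hH0 : 0 < H := by linarith
  have hlogH : C * (n : ℝ) ^ K' + 1 ≤ Real.log H := by
    rw [Real.le_log_iff_exp_le hH0]; exact le_max_right _ _
  have hlogH0 : 0 ≤ Real.log H := Real.log_nonneg hH1
  -- Dirichlet
  obtain ⟨P, hP0, hPdeg, hPcoeff, hPval⟩ := exists_int_poly_small_value ξ n hn50 H hHξ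
  -- feed the floor
  have hQ0 : P.toMvPolynomial (0 : Fin 1) ≠ 0 := fun h =>
    hP0 (Polynomial.toMvPolynomial_injective (0 : Fin 1) (by rw [h, map_zero]))
  have hkey := hfl (P.toMvPolynomial (0 : Fin 1)) hQ0
  rw [MvPolynomial.aeval_toMvPolynomial] at hkey
  -- sizes of the image
  have hnat : ∀ k, (P.coeff k).natAbs ≤ ⌊H⌋₊ := fun k => by
    rw [Nat.le_floor_iff hH0.le, ← Int.cast_natCast, Int.natCast_natAbs, Int.cast_abs]
    exact hPcoeff k
  obtain ⟨hFdeg, hFht⟩ := totalDegree_mvNatHeight_toMvPolynomial_le P ⌊H⌋₊ hnat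
  set X₁ : ℝ := max 1 ((P.toMvPolynomial (0 : Fin 1)).totalDegree : ℝ) with hX₁
  set Y₁ : ℝ := max 1 (mvNatHeight (P.toMvPolynomial (0 : Fin 1)) : ℝ) with hY₁
  have hX1 : 1 ≤ X₁ := le_max_left _ _
  have hXn : X₁ ≤ n := max_le hn1 (by exact_mod_cast hFdeg.trans hPdeg)
  have hY1 : 1 ≤ Y₁ := le_max_left _ _
  have hYH : Y₁ ≤ H := max_le hH1 ((show (mvNatHeight (P.toMvPolynomial (0 : Fin 1)) : ℝ) ≤
    (⌊H⌋₊ : ℝ) by exact_mod_cast hFht).trans (Nat.floor_le hH0.le))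
  have hlogY : Real.log Y₁ ≤ Real.log H := Real.log_le_log (by linarith) hYH
  have hlogY0 : 0 ≤ Real.log Y₁ := Real.log_nonneg hY1
  have hXA : X₁ ^ A ≤ (n : ℝ) ^ A' :=
    (Real.rpow_le_rpow_of_exponent_le hX1 (le_max_left _ _)).trans
      (Real.rpow_le_rpow (by linarith) hXn hA'0)
  have hXK : X₁ ^ K ≤ (n : ℝ) ^ K' :=
    (Real.rpow_le_rpow_of_exponent_le hX1 (le_max_left _ _)).trans
      (Real.rpow_le_rpow (by linarith) hXn hK'0)
  have hnA0 : 0 ≤ (n : ℝ) ^ A' := by positivity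
  -- the floor exponent is at most 0.003 n log H + C n^K'
  have hexpo : C * (X₁ ^ A * Real.log Y₁ + X₁ ^ K) ≤ 3 / 1000 * n * Real.log H + C * (n : ℝ) ^ K' := by
    have h1 : X₁ ^ A * Real.log Y₁ ≤ (n : ℝ) ^ A' * Real.log H :=
      mul_le_mul hXA hlogY hlogY0 hnA0
    have h2 : C * ((n : ℝ) ^ A' * Real.log H) ≤ 3 / 1000 * n * Real.log H := by
      have := mul_le_mul_of_nonneg_right hn hlogH0
      linarith
    have h3 := mul_le_mul_of_nonneg_left (add_le_add h1 hXK) hC.le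
    linarith
  -- compare with Dirichlet's upper bound
  have hlow : Real.exp (-(3 / 1000 * n * Real.log H + C * (n : ℝ) ^ K')) ≤ ‖aeval ξ P‖ :=
    (Real.exp_le_exp.mpr (by linarith)).trans hkey
  have hchain := hlow.trans hPval
  rw [Real.exp_le_exp] at hchain
  -- 0.455 n log H ≤ 0.003 n log H + C n^K'  contradicts  log H > C n^K'  (n ≥ 50)
  have h45 : (452 / 1000 : ℝ) * n * Real.log H ≥ Real.log H := by
    have : (1 : ℝ) ≤ 452 / 1000 * n := by
      have h50 : (50 : ℝ) ≤ n := by exact_mod_cast hn50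
      linarith
    nlinarith
  linarith


end Summit.Schanuel.Schanuel.Cruxes.KhovanskiiApproxType.Disproof
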